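import Literature.Analysis.FluidPDE.BeiraoDaVeigaEnstrophyGronwall
import Literature.Analysis.FluidPDE.MillerMiddleEigenvalueTorus
import Literature.Analysis.FluidPDE.NullLagrangianDeterminant
import HarnessLib

/-!
# Miller's middle-eigenvalue enstrophy inequality on `ℝ³` (Miller 2019, Thm. 1.1; Neustupa–Penel 2001)

Analysis/FluidPDE proof file (theorems only: no definition, no named fact, no `sorry`). It is the
`ℝ³` engine for the discharge of the named fact `Miller2019.middleEigenvalueCriterion`
(`MillerMiddleEigenvalueCriterion.lean`), in the same way as `BeiraoDaVeigaEnstrophyGronwall.lean`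
is the engine for `BeiraoDaVeiga1995_gradientCriterion`: the printed proof of E. Miller,
*A regularity criterion for the Navier–Stokes equation involving only the middle eigenvalue of the
strain tensor*, Arch. Ration. Mech. Anal. 235 (2020) 99–139 = arXiv:1710.05569, Theorem 1.1
(= Thm. 5.2, arXiv pp. 16–17), is followed step by step, in the velocity-gradient bookkeeping of
the tree's Serrin / Beirão da Veiga chain (`SerrinEnstrophyGronwall`, `BeiraoDaVeigaEnstrophyGronwall`):

* **Pointwise** (Miller's Lemma 5.1 `−det S ≤ ½|S|²λ₂⁺`, arXiv p. 16, here through the tree's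
  `Miller2019.neg_det_le_half_normSq_mul_posPart_middleEigenvalue` of
  `MillerMiddleEigenvalueTorus.lean`, combined with the trace-free algebra
  `Σⱼ⟪L eⱼ, L(L eⱼ)⟫ = ½ det(G + Gᵀ) − det G`, Betchov 1956): for a trace-free linear map `L` of
  `ℝ³`, `−Σⱼ ⟪L eⱼ, L (L eⱼ)⟫ ≤ 2 λ₂⁺(L) |L|²_F + det L` (`neg_sum_inner_apply_apply_le_midStrain`),
  where `λ₂(L)` is the tree's middle principal strain `strainEigenvalues L _ 1`
  (`LerayGaugeStrainSpectrum.lean`, with its two-frame Courant–Fischer characterisation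
  `strainEigenvalues_mid_le_iff`); `λ₂` is `1`-Lipschitz in `L` (Weyl) and `≤ ‖L‖`.
* **Null Lagrangian**: `∫ det ∇v = 0` for a bounded smooth field with bounded gradient in `L²`
  (`integral_det_fderiv_eq_zero`, from the tree's `integral_mul_det_fderiv_eq` of
  `NullLagrangianDeterminant.lean` and the cut-offs `cutoff R → 1`; Evans, *PDE*, §8.1.4.b).
* **Weighted key estimate** (`integral_weight_mul_sq_norm_fderiv_apply_le`): for a continuous
  bounded weight `0 ≤ φ` with `∫ φ^r < ∞`, `3/2 < r`,
  `∫ φ ‖∂ⱼv‖² ≤ (∫ φ^r)^{1/r} (∫‖∂ⱼv‖²)^{1-3/(2r)} (K² Σᵢ∫‖∂ᵢ∂ⱼv‖²)^{3/(2r)}` — Hölder,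
  interpolation between `L²` and `L⁶`, Sobolev (the three printed steps of Thm. 5.2's proof).
* **Slice** (`integral_sum_inner_fderiv_le_of_momentum_of_midStrain`): with the momentum equation,
  `∫ Σᵢ⟪∂ᵢv, ∂ᵢW⟫ ≤ C(θ) 2^{1/θ} ν^{1-1/θ} ((∫ m^r)^{1/r})^{1/θ} ∫|∇v|²_F` for ANY nonnegative
  two-frame majorant `m` of `λ₂(∇v(x))` with `∫ m^r < ∞` (`θ = 1 − 3/(2r)`; only the continuous
  weight `λ₂⁺ ∘ ∇v ≤ m` is ever integrated against, so no measurability of `m` is needed).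
* **Slab** (`miller_enstrophy_le_mul_exp`, `miller_enstrophy_bound`): Grönwall in `ℝ≥0∞` on a slab
  in Tao's `L²`-Sobolev class, `∫|∇u(s)|²_F ≤ exp(C ν^{1−p} ∫₀ˢ (∫ m(t)^r)^{2/(2r−3)}) ∫|∇u(0)|²_F`,
  `p = 2r/(2r−3)` (`2/p + 3/r = 2`).

Deviation from print, labelled: Miller works with the strain `S` and `‖S‖²₂ = ½‖∇u‖²₂`; here the
enstrophy is `∫ |∇u|²_F` and the production density is bounded by `2λ₂⁺|∇u|²_F + det ∇u`
(`|S|_F ≤ |∇u|_F`), which changes only the unspecified constant `C_q`. Viscosity `ν > 0` is kept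
explicit (print: `ν = 1`). Cell pub-nsfunc: search for candidate a priori estimates; no regularity
claim (a published conditional criterion).

## References

* [Miller2019] E. Miller, Arch. Ration. Mech. Anal. 235 (2020) 99–139, doi:10.1007/s00205-019-01419-z,
  arXiv:1710.05569 — Thm. 1.1 = Thm. 5.2 (arXiv pp. 16–17), Lemma 5.1 (arXiv p. 16).
* [NeustupaPenel2001] J. Neustupa, P. Penel, in *Mathematical Fluid Mechanics*, Birkhäuser 2001,
  237–265, doi:10.1007/978-3-0348-8243-9_10 — Thm. 2 (priority for the `λ₂⁺` criterion, per
  Miller's Addendum doi:10.1007/s00205-020-01527-1).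
* [HornJohnson2013] R. A. Horn, C. R. Johnson, *Matrix Analysis*, 2nd ed., CUP 2013 — Thm. 4.2.6
  (Courant–Fischer), Cor. 4.3.15 (Weyl).
* [Evans2010] L. C. Evans, *Partial Differential Equations*, 2nd ed., AMS 2010 — §8.1.4.b
  (determinants are null Lagrangians).
* [BerselliGaldi2002] L. C. Berselli, G. P. Galdi, Proc. AMS 130 (2002) 3585–3595 — (1.3) p. 3586
  (the gradient criterion whose chain this file clones).
-/

noncomputable section

open MeasureTheory Set Function Filter Topology InnerProductSpace
open scoped ENNReal NNReal ContDiff RealInnerProductSpace Laplacian Matrix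

namespace Literature.Analysis.FluidPDE

/-! ### Pointwise: the middle principal strain of `Du(x)` -/

section Pointwise

/-- **Weyl's perturbation bound for the middle principal strain**: `λ₂(B) ≤ λ₂(A) + ‖B − A‖`
(Courant–Fischer, Horn–Johnson Thm. 4.2.6 / Cor. 4.3.15: the two-frame witnessing `λ₂(A) ≤ λ₂(A)`
witnesses `λ₂(B) ≤ λ₂(A) + ‖B − A‖`). [cite: HornJohnson2013, Thm 4.2.6] -/
theorem midStrain_le_midStrain_add_norm_sub
    (A B : EuclideanSpace ℝ (Fin 3) →L[ℝ] EuclideanSpace ℝ (Fin 3)) :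
    strainEigenvalues (B : EuclideanSpace ℝ (Fin 3) →ₗ[ℝ] EuclideanSpace ℝ (Fin 3))
        finrank_euclideanSpace_fin 1 ≤
      strainEigenvalues (A : EuclideanSpace ℝ (Fin 3) →ₗ[ℝ] EuclideanSpace ℝ (Fin 3))
        finrank_euclideanSpace_fin 1 + ‖B - A‖ := by
  obtain ⟨v, w, hv, hw, hvw, h⟩ :=
    (strainEigenvalues_mid_le_iff (A : EuclideanSpace ℝ (Fin 3) →ₗ[ℝ] EuclideanSpace ℝ (Fin 3))
      finrank_euclideanSpace_fin _).1 le_rfl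
  refine (strainEigenvalues_mid_le_iff (B : EuclideanSpace ℝ (Fin 3) →ₗ[ℝ] EuclideanSpace ℝ (Fin 3))
    finrank_euclideanSpace_fin _).2 ⟨v, w, hv, hw, hvw, fun α β => ?_⟩
  set z : EuclideanSpace ℝ (Fin 3) := α • v + β • w with hz
  have hz2 : ‖z‖ ^ 2 = α ^ 2 + β ^ 2 := norm_sq_smul_add_smul hv hw hvw α β
  have hsplit : ⟪(B : EuclideanSpace ℝ (Fin 3) →ₗ[ℝ] EuclideanSpace ℝ (Fin 3)) z, z⟫_ℝ =
      ⟪(A : EuclideanSpace ℝ (Fin 3) →ₗ[ℝ] EuclideanSpace ℝ (Fin 3)) z, z⟫_ℝ + ⟪(B - A) z, z⟫_ℝ := by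
    simp only [ContinuousLinearMap.coe_coe, sub_apply, inner_sub_left]
    ring
  have hpert : ⟪(B - A) z, z⟫_ℝ ≤ ‖B - A‖ * (α ^ 2 + β ^ 2) := by
    calc ⟪(B - A) z, z⟫_ℝ ≤ ‖(B - A) z‖ * ‖z‖ := real_inner_le_norm _ _
      _ ≤ ‖B - A‖ * ‖z‖ * ‖z‖ := by gcongr; exact (B - A).le_opNorm z
      _ = ‖B - A‖ * (α ^ 2 + β ^ 2) := by rw [← hz2]; ring
  rw [hsplit]
  have hA := h α β
  nlinarith

/-- The middle principal strain is `1`-Lipschitz in the operator norm (Weyl; Horn–Johnson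
Cor. 4.3.15 for the symmetric part, `‖sym(B − A)‖ ≤ ‖B − A‖`). [cite: HornJohnson2013, Thm 4.2.6] -/
theorem lipschitzWith_midStrain :
    LipschitzWith 1 (fun L : EuclideanSpace ℝ (Fin 3) →L[ℝ] EuclideanSpace ℝ (Fin 3) =>
      strainEigenvalues (L : EuclideanSpace ℝ (Fin 3) →ₗ[ℝ] EuclideanSpace ℝ (Fin 3))
        finrank_euclideanSpace_fin 1) := by
  refine LipschitzWith.of_le_add fun A B => ?_
  rw [dist_eq_norm]
  have h := midStrain_le_midStrain_add_norm_sub B A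
  exact h

/-- The middle principal strain is bounded by the operator norm: `λ₂(L) ≤ ‖L‖` (Rayleigh
quotients of `L` are at most `‖L‖`). [cite: HornJohnson2013, Thm 4.2.6] -/
theorem midStrain_le_opNorm (L : EuclideanSpace ℝ (Fin 3) →L[ℝ] EuclideanSpace ℝ (Fin 3)) :
    strainEigenvalues (L : EuclideanSpace ℝ (Fin 3) →ₗ[ℝ] EuclideanSpace ℝ (Fin 3))
      finrank_euclideanSpace_fin 1 ≤ ‖L‖ := by
  set e := EuclideanSpace.basisFun (Fin 3) ℝ with he
  have hon := (EuclideanSpace.basisFun (Fin 3) ℝ).orthonormal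
  have h0 : ‖e 0‖ = 1 := hon.1 0
  have h1 : ‖e 1‖ = 1 := hon.1 1
  have h01 : ⟪e 0, e 1⟫_ℝ = 0 := hon.2 (by decide)
  refine (strainEigenvalues_mid_le_iff (L : EuclideanSpace ℝ (Fin 3) →ₗ[ℝ] EuclideanSpace ℝ (Fin 3))
    finrank_euclideanSpace_fin _).2 ⟨e 0, e 1, h0, h1, h01, fun α β => ?_⟩
  set z : EuclideanSpace ℝ (Fin 3) := α • e 0 + β • e 1 with hz
  have hz2 : ‖z‖ ^ 2 = α ^ 2 + β ^ 2 := norm_sq_smul_add_smul h0 h1 h01 α β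
  calc ⟪(L : EuclideanSpace ℝ (Fin 3) →ₗ[ℝ] EuclideanSpace ℝ (Fin 3)) z, z⟫_ℝ
      ≤ ‖L z‖ * ‖z‖ := real_inner_le_norm _ _
    _ ≤ ‖L‖ * ‖z‖ * ‖z‖ := by gcongr; exact L.le_opNorm z
    _ = ‖L‖ * (α ^ 2 + β ^ 2) := by rw [← hz2]; ring

/-- `tr G³ = 3 det G` for a trace-free `3 × 3` array (Newton's identity `p₃ = 3e₃` when
`e₁ = 0`). [folklore] -/
private theorem sum_cube_eq_three_mul_det (G : Fin 3 → Fin 3 → ℝ) (htr : ∑ i, G i i = 0) :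
    ∑ i, ∑ j, ∑ k, G i j * G j k * G k i = 3 * Matrix.det (Matrix.of fun i j => G i j) := by
  rw [Matrix.det_fin_three]
  simp only [Fin.sum_univ_three, Matrix.of_apply] at htr ⊢
  have h00 : G 0 0 = -(G 1 1 + G 2 2) := by linarith
  rw [h00]
  ring

/-- **The production–determinant identity** for a trace-free `3 × 3` array `G` (`Gᵢⱼ = ∂ⱼvᵢ`):
`Σ_{ijk} Gᵢⱼ Gᵢₖ Gₖⱼ = ½ det (G + Gᵀ) − det G` (from `3 tr GᵀGG = 4 tr S³ − tr G³`,
`tr S³ = 3 det S`, `tr G³ = 3 det G`; Betchov 1956; Miller 2020, §4–5). [cite: Miller2019, Lemma 5.1 (with Prop. 4.8)] -/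
private theorem stretch_eq_half_det_add_transpose_sub_det (G : Fin 3 → Fin 3 → ℝ)
    (htr : ∑ i, G i i = 0) :
    ∑ i, ∑ j, ∑ k, G i j * G i k * G k j =
      2⁻¹ * Matrix.det (Matrix.of fun i j => G i j + G j i) - Matrix.det (Matrix.of fun i j => G i j) := by
  rw [Matrix.det_fin_three, Matrix.det_fin_three]
  simp only [Fin.sum_univ_three, Matrix.of_apply] at htr ⊢
  have h00 : G 0 0 = -(G 1 1 + G 2 2) := by linarith
  rw [h00]
  ring

/-- `Σᵢⱼ (Gᵢⱼ + Gⱼᵢ)² ≤ 4 Σᵢⱼ Gᵢⱼ²` (`|S|_F ≤ |G|_F`). [folklore] -/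
private theorem sum_sq_add_transpose_le (G : Fin 3 → Fin 3 → ℝ) :
    ∑ i, ∑ j, (G i j + G j i) ^ 2 ≤ 4 * ∑ i, ∑ j, G i j ^ 2 := by
  simp only [Fin.sum_univ_three]
  nlinarith [sq_nonneg (G 0 1 - G 1 0), sq_nonneg (G 0 2 - G 2 0), sq_nonneg (G 1 2 - G 2 1)]

/-- The coordinate form of the production density: for a linear map `L` of `ℝ³` with matrix
`G = stdMatrix L` (`Gᵢⱼ = (L eⱼ)ᵢ`), `Σⱼ ⟪L eⱼ, L (L eⱼ)⟫ = Σ_{ijk} Gᵢⱼ Gᵢₖ Gₖⱼ`. [folklore] -/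
private theorem sum_inner_apply_apply_eq_sum
    (L : EuclideanSpace ℝ (Fin 3) →L[ℝ] EuclideanSpace ℝ (Fin 3)) :
    ∑ j, ⟪L (EuclideanSpace.basisFun (Fin 3) ℝ j), L (L (EuclideanSpace.basisFun (Fin 3) ℝ j))⟫_ℝ =
      ∑ i, ∑ j, ∑ k,
        stdMatrix (L : EuclideanSpace ℝ (Fin 3) →ₗ[ℝ] EuclideanSpace ℝ (Fin 3)) i j *
        stdMatrix (L : EuclideanSpace ℝ (Fin 3) →ₗ[ℝ] EuclideanSpace ℝ (Fin 3)) i k *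
        stdMatrix (L : EuclideanSpace ℝ (Fin 3) →ₗ[ℝ] EuclideanSpace ℝ (Fin 3)) k j := by
  set e := EuclideanSpace.basisFun (Fin 3) ℝ with he
  have hG : ∀ i j, stdMatrix (L : EuclideanSpace ℝ (Fin 3) →ₗ[ℝ] EuclideanSpace ℝ (Fin 3)) i j =
      (L (e j)) i := fun i j => by
    rw [stdMatrix_apply, ContinuousLinearMap.coe_coe, he, EuclideanSpace.basisFun_apply]
  -- expand `L (e j) = Σₖ (L (e j))ₖ • eₖ` inside the outer `L`
  have hexp : ∀ w : EuclideanSpace ℝ (Fin 3), L w = ∑ k, w k • L (e k) := by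
    intro w
    conv_lhs => rw [← (EuclideanSpace.basisFun (Fin 3) ℝ).sum_repr' w]
    simp [map_sum, map_smul, he, EuclideanSpace.inner_single_left]
  have hinner : ∀ x y : EuclideanSpace ℝ (Fin 3), ⟪x, y⟫_ℝ = ∑ i, x i * y i := by
    intro x y
    rw [EuclideanSpace.inner_eq_star_dotProduct, dotProduct]
    simp [mul_comm]
  simp_rw [hG]
  calc ∑ j, ⟪L (e j), L (L (e j))⟫_ℝ
      = ∑ j, ∑ k, (L (e j)) k * ⟪L (e j), L (e k)⟫_ℝ := by
        refine Finset.sum_congr rfl fun j _ => ?_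
        conv_lhs => rw [hexp (L (e j))]
        rw [inner_sum]
        exact Finset.sum_congr rfl fun k _ => by rw [real_inner_smul_right]
    _ = ∑ j, ∑ k, (L (e j)) k * ∑ i, (L (e j)) i * (L (e k)) i := by
        simp_rw [hinner]
    _ = ∑ j, ∑ i, ∑ k, (L (e j)) i * (L (e k)) i * (L (e j)) k := by
        refine Finset.sum_congr rfl fun j _ => ?_
        rw [Finset.sum_comm]
        refine Finset.sum_congr rfl fun i _ => ?_
        rw [Finset.mul_sum]
        refine Finset.sum_congr rfl fun k _ => by ring
    _ = ∑ i, ∑ j, ∑ k, (L (e j)) i * (L (e k)) i * (L (e j)) k := Finset.sum_comm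

/-- **The pointwise production bound via the middle principal strain** (Miller 2020, Lemma 5.1
`−det S ≤ ½|S|²λ₂⁺` combined with the algebra `Σⱼ⟪L eⱼ, L(L eⱼ)⟫ = ½ det(G + Gᵀ) − det G` for a
trace-free `L` with matrix `G`, and `|S|_F ≤ |G|_F`): for a trace-free linear map `L` of `ℝ³`,
`−Σⱼ ⟪L eⱼ, L (L eⱼ)⟫ ≤ 2 λ₂⁺(L) |L|²_F + det L`. [cite: Miller2019, Lemma 5.1] -/
theorem neg_sum_inner_apply_apply_le_midStrain
    (L : EuclideanSpace ℝ (Fin 3) →L[ℝ] EuclideanSpace ℝ (Fin 3))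
    (htr : LinearMap.trace ℝ (EuclideanSpace ℝ (Fin 3))
      (L : EuclideanSpace ℝ (Fin 3) →ₗ[ℝ] EuclideanSpace ℝ (Fin 3)) = 0) :
    -∑ j, ⟪L (EuclideanSpace.basisFun (Fin 3) ℝ j), L (L (EuclideanSpace.basisFun (Fin 3) ℝ j))⟫_ℝ ≤
      2 * max (strainEigenvalues (L : EuclideanSpace ℝ (Fin 3) →ₗ[ℝ] EuclideanSpace ℝ (Fin 3))
          finrank_euclideanSpace_fin 1) 0 * FluidPDE.frobeniusNormSq L +
        LinearMap.det (L : EuclideanSpace ℝ (Fin 3) →ₗ[ℝ] EuclideanSpace ℝ (Fin 3)) := by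
  set Ll : EuclideanSpace ℝ (Fin 3) →ₗ[ℝ] EuclideanSpace ℝ (Fin 3) := ↑L with hLl
  set G : Matrix (Fin 3) (Fin 3) ℝ := stdMatrix Ll with hGdef
  -- trace-free matrix
  have htrG : ∑ i, G i i = 0 := by
    have h := trace_stdMatrix Ll
    rw [htr] at h
    simpa [Matrix.trace, Matrix.diag, hGdef] using h
  -- the production density in coordinates, and the determinant identity
  have hU : ∑ j, ⟪L (EuclideanSpace.basisFun (Fin 3) ℝ j), L (L (EuclideanSpace.basisFun (Fin 3) ℝ j))⟫_ℝ
      = ∑ i, ∑ j, ∑ k, G i j * G i k * G k j := sum_inner_apply_apply_eq_sum L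
  have hid := stretch_eq_half_det_add_transpose_sub_det G htrG
  have hofG : (Matrix.of fun i j => G i j) = G := by ext i j; rfl
  have hdetG : Matrix.det G = LinearMap.det Ll := LinearMap.det_toMatrix _ Ll
  -- the symmetric matrix `N = G + Gᵀ` and Miller's Lemma 5.1
  set M : Matrix (Fin 3) (Fin 3) ℝ := stdMatrix Ll + (stdMatrix Ll)ᴴ with hMdef
  have hMH : M.IsHermitian := Matrix.isHermitian_add_transpose_self _
  have hsym : M.IsSymm := Matrix.isHermitian_iff_isSymm.1 hMH
  have hMij : ∀ i j, M i j = G i j + G j i := fun i j => by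
    simp [hMdef, hGdef, Matrix.add_apply]
  have htrM : M.trace = 0 := by
    simp only [Matrix.trace, Matrix.diag, hMij]
    rw [Finset.sum_add_distrib, htrG, add_zero]
  have hofM : (Matrix.of fun i j => G i j + G j i) = M := by
    ext i j; rw [Matrix.of_apply, hMij]
  have hmil := Miller2019.neg_det_le_half_normSq_mul_posPart_middleEigenvalue
    (Fintype.card_fin 3) M hsym htrM
  -- the eigenvalue in Miller's lemma is `2 λ₂(L)`
  have hbridge : (Matrix.isHermitian_iff_isSymm.mpr hsym).eigenvalues₀
      (Fin.cast (Fintype.card_fin 3).symm 1) = 2 * strainEigenvalues Ll finrank_euclideanSpace_fin 1 := by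
    rw [strainEigenvalues_eq_eigenvalues₀ Ll 1]
    have hpi : (Matrix.isHermitian_iff_isSymm.mpr hsym).eigenvalues₀ =
        (Matrix.isHermitian_add_transpose_self (stdMatrix Ll)).eigenvalues₀ := rfl
    rw [hpi]
    ring
  rw [hbridge] at hmil
  -- `Σ M² ≤ 4 |G|²_F = 4 |L|²_F`
  have hfro : ∑ i, ∑ j, M i j ^ 2 ≤ 4 * FluidPDE.frobeniusNormSq L := by
    rw [frobeniusNormSq_eq_sum_sq_stdMatrix L]
    simp only [hMij]
    exact sum_sq_add_transpose_le G
  have hmax : max (2 * strainEigenvalues Ll finrank_euclideanSpace_fin 1) 0 =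
      2 * max (strainEigenvalues Ll finrank_euclideanSpace_fin 1) 0 := by
    rcases le_total 0 (strainEigenvalues Ll finrank_euclideanSpace_fin 1) with h | h
    · rw [max_eq_left h, max_eq_left (by linarith)]
    · rw [max_eq_right h, max_eq_right (by linarith), mul_zero]
  rw [hmax] at hmil
  have hl0 : 0 ≤ max (strainEigenvalues Ll finrank_euclideanSpace_fin 1) 0 := le_max_right _ _
  have hF0 : 0 ≤ FluidPDE.frobeniusNormSq L := FluidPDE.frobeniusNormSq_nonneg _
  have hM2 : 0 ≤ ∑ i, ∑ j, M i j ^ 2 := Finset.sum_nonneg fun i _ => Finset.sum_nonneg fun j _ => sq_nonneg _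
  -- assemble
  rw [hU, hid, hofG, hofM, hdetG]
  nlinarith [mul_le_mul_of_nonneg_right hfro hl0, hmil]

end Pointwise

/-! ### The Jacobian determinant integrates to zero on `ℝ³` -/

section NullLagrangian

/-- `‖∇vᵢ(y)‖ ≤ ‖Dv(y)‖` for the coordinate gradients of a differentiable field. [folklore] -/
private theorem norm_gradient_coord_le_norm_fderiv
    {v : EuclideanSpace ℝ (Fin 3) → EuclideanSpace ℝ (Fin 3)} {y : EuclideanSpace ℝ (Fin 3)}
    (hd : DifferentiableAt ℝ v y) (i : Fin 3) :
    ‖gradient (fun z => v z i) y‖ ≤ ‖fderiv ℝ v y‖ := by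
  set w := gradient (fun z => v z i) y with hw
  have h1 : ‖w‖ ^ 2 ≤ ‖fderiv ℝ v y‖ * ‖w‖ := by
    rw [← real_inner_self_eq_norm_sq, hw, inner_gradient_coord_eq hd i]
    calc fderiv ℝ v y (gradient (fun z => v z i) y) i
        ≤ |fderiv ℝ v y (gradient (fun z => v z i) y) i| := le_abs_self _
      _ ≤ ‖fderiv ℝ v y (gradient (fun z => v z i) y)‖ := by
          simpa [Real.norm_eq_abs] using
            PiLp.norm_apply_le (fderiv ℝ v y (gradient (fun z => v z i) y)) i
      _ ≤ ‖fderiv ℝ v y‖ * ‖gradient (fun z => v z i) y‖ := (fderiv ℝ v y).le_opNorm _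
  by_cases hw0 : ‖w‖ = 0
  · rw [hw0]; exact norm_nonneg _
  · exact le_of_mul_le_mul_right (by nlinarith [h1]) (lt_of_le_of_ne (norm_nonneg _) (Ne.symm hw0))

/-- **Hadamard-type bound for the Jacobian determinant on `ℝ³`**:
`|det Dv(y)| ≤ ½ ‖Dv(y)‖ |Dv(y)|²_F` (`det Dv = ⟪∇v₀, ∇v₁ × ∇v₂⟫`,
`‖∇v₁ × ∇v₂‖ ≤ ‖∇v₁‖ ‖∇v₂‖ ≤ ½ |Dv|²_F` and `‖∇v₀‖ ≤ ‖Dv‖`). [folklore] -/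
private theorem abs_det_fderiv_le
    {v : EuclideanSpace ℝ (Fin 3) → EuclideanSpace ℝ (Fin 3)} {y : EuclideanSpace ℝ (Fin 3)}
    (hd : DifferentiableAt ℝ v y) :
    |LinearMap.det (fderiv ℝ v y : EuclideanSpace ℝ (Fin 3) →ₗ[ℝ] EuclideanSpace ℝ (Fin 3))| ≤
      1 / 2 * ‖fderiv ℝ v y‖ * FluidPDE.frobeniusNormSq (fderiv ℝ v y) := by
  rw [det_fderiv_eq_inner_gradient_cross hd]
  set g0 := gradient (fun z => v z 0) y
  set g1 := gradient (fun z => v z 1) y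
  set g2 := gradient (fun z => v z 2) y
  have hcross : ‖cross g1 g2‖ ≤ ‖g1‖ * ‖g2‖ := by
    rw [norm_cross]
    exact mul_le_of_le_one_right (by positivity) (Real.sin_le_one _)
  have hF := frobeniusNormSq_fderiv_eq_sum_norm_gradient_sq hd
  have hgg : ‖g1‖ * ‖g2‖ ≤ (1 / 2) * FluidPDE.frobeniusNormSq (fderiv ℝ v y) := by
    rw [hF]
    nlinarith [sq_nonneg (‖g1‖ - ‖g2‖), sq_nonneg ‖g0‖]
  calc |⟪g0, cross g1 g2⟫_ℝ| ≤ ‖g0‖ * ‖cross g1 g2‖ := abs_real_inner_le_norm _ _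
    _ ≤ ‖fderiv ℝ v y‖ * (‖g1‖ * ‖g2‖) :=
        mul_le_mul (norm_gradient_coord_le_norm_fderiv hd 0) hcross (norm_nonneg _) (norm_nonneg _)
    _ ≤ ‖fderiv ℝ v y‖ * ((1 / 2) * FluidPDE.frobeniusNormSq (fderiv ℝ v y)) :=
        mul_le_mul_of_nonneg_left hgg (norm_nonneg _)
    _ = 1 / 2 * ‖fderiv ℝ v y‖ * FluidPDE.frobeniusNormSq (fderiv ℝ v y) := by ring

/-- `|∇v|²_F` is integrable for a `C¹` field with `Dv ∈ L²`. [folklore] -/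
private theorem integrable_frobeniusNormSq_fderiv
    {v : EuclideanSpace ℝ (Fin 3) → EuclideanSpace ℝ (Fin 3)} (hv : ContDiff ℝ 1 v)
    (hv1 : ∫⁻ x, ‖iteratedFDeriv ℝ 1 v x‖ₑ ^ 2 < ⊤) :
    Integrable (fun x => FluidPDE.frobeniusNormSq (fderiv ℝ v x)) volume := by
  have hDv_eq : ∀ x, ‖fderiv ℝ v x‖ = ‖iteratedFDeriv ℝ 1 v x‖ := fun x => by
    rw [← norm_iteratedFDeriv_fderiv, norm_iteratedFDeriv_zero]
  have l2Dv : ∫⁻ x, ‖fderiv ℝ v x‖ₑ ^ 2 < ⊤ :=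
    lintegral_enorm_sq_lt_top_of_norm_le (fun x => (hDv_eq x).le) hv1
  have lfrob : ∫⁻ x, ENNReal.ofReal (FluidPDE.frobeniusNormSq (fderiv ℝ v x)) < ⊤ :=
    calc ∫⁻ x, ENNReal.ofReal (FluidPDE.frobeniusNormSq (fderiv ℝ v x))
        ≤ ∫⁻ x, 3 * ‖fderiv ℝ v x‖ₑ ^ 2 :=
          lintegral_mono fun x => ofReal_frobeniusNormSq_le_three_mul_enorm_sq _
      _ = 3 * ∫⁻ x, ‖fderiv ℝ v x‖ₑ ^ 2 := lintegral_const_mul' _ _ (by norm_num)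
      _ < ⊤ := ENNReal.mul_lt_top (by norm_num) l2Dv
  exact integrable_of_continuous_of_nonneg (FluidPDE.continuous_frobeniusNormSq_fderiv hv (by simp))
    (fun x => FluidPDE.frobeniusNormSq_nonneg _) lfrob

/-- `det ∇v` is integrable for a `C¹` field with bounded gradient `Dv ∈ L²`
(`|det Dv| ≤ ½ B₁ |Dv|²_F`). [folklore] -/
private theorem integrable_det_fderiv
    {v : EuclideanSpace ℝ (Fin 3) → EuclideanSpace ℝ (Fin 3)} (hv : ContDiff ℝ 1 v)
    {B₁ : ℝ} (hB₁ : ∀ x, ‖fderiv ℝ v x‖ ≤ B₁)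
    (hv1 : ∫⁻ x, ‖iteratedFDeriv ℝ 1 v x‖ₑ ^ 2 < ⊤) :
    Integrable (fun x => LinearMap.det
      (fderiv ℝ v x : EuclideanSpace ℝ (Fin 3) →ₗ[ℝ] EuclideanSpace ℝ (Fin 3))) volume := by
  have hdV : ∀ y, DifferentiableAt ℝ v y := fun y => (hv.differentiable (by simp)) y
  have hgc : Continuous fun x => LinearMap.det
      (fderiv ℝ v x : EuclideanSpace ℝ (Fin 3) →ₗ[ℝ] EuclideanSpace ℝ (Fin 3)) := by
    have : (fun x => LinearMap.det
        (fderiv ℝ v x : EuclideanSpace ℝ (Fin 3) →ₗ[ℝ] EuclideanSpace ℝ (Fin 3))) =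
        fun x => (fderiv ℝ v x).det := rfl
    rw [this]
    exact ContinuousLinearMap.continuous_det.comp (hv.continuous_fderiv (by simp))
  refine ((integrable_frobeniusNormSq_fderiv hv hv1).const_mul (1 / 2 * B₁)).mono'
    hgc.aestronglyMeasurable (Eventually.of_forall fun y => ?_)
  rw [Real.norm_eq_abs]
  refine (abs_det_fderiv_le (hdV y)).trans ?_
  exact mul_le_mul_of_nonneg_right (mul_le_mul_of_nonneg_left (hB₁ y) (by norm_num))
    (FluidPDE.frobeniusNormSq_nonneg _)

/-- **`∫ det ∇v = 0` on `ℝ³`** for a bounded smooth field with bounded, square-integrable gradient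
(the determinant is a null Lagrangian: `∫ φ det ∇v = −∫ v₀ ⟪∇v₁ × ∇v₂, ∇φ⟫`,
`integral_mul_det_fderiv_eq`, tested against the cut-offs `φ_R → 1` with `‖∇φ_R‖ ≤ C/R`; Evans,
*PDE*, §8.1.4.b, Thm. 2; for divergence-free `v` this is Betchov's `∫ tr (∇v)³ = 0`, J. Fluid
Mech. 1 (1956), since `tr G³ = 3 det G` when `tr G = 0`). [cite: Evans2010, §8.1.4.b (determinants are null Lagrangians)] -/
theorem integral_det_fderiv_eq_zero
    {v : EuclideanSpace ℝ (Fin 3) → EuclideanSpace ℝ (Fin 3)} (hv : ContDiff ℝ ∞ v)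
    {B : ℝ} (hB : ∀ x, ‖v x‖ ≤ B) {B₁ : ℝ} (hB₁ : ∀ x, ‖fderiv ℝ v x‖ ≤ B₁)
    (hv1 : ∫⁻ x, ‖iteratedFDeriv ℝ 1 v x‖ₑ ^ 2 < ⊤) :
    ∫ x, LinearMap.det (fderiv ℝ v x : EuclideanSpace ℝ (Fin 3) →ₗ[ℝ] EuclideanSpace ℝ (Fin 3)) = 0 := by
  have hB0 : 0 ≤ B := (norm_nonneg _).trans (hB 0)
  have hdV : ∀ y, DifferentiableAt ℝ v y := fun y => (hv.differentiable (by simp)) y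
  have cDv : Continuous (fderiv ℝ v) := hv.continuous_fderiv (by simp)
  -- the integrand
  set g : EuclideanSpace ℝ (Fin 3) → ℝ := fun x =>
    LinearMap.det (fderiv ℝ v x : EuclideanSpace ℝ (Fin 3) →ₗ[ℝ] EuclideanSpace ℝ (Fin 3)) with hg
  have hgc : Continuous g := by
    have : g = fun x => (fderiv ℝ v x).det := rfl
    rw [this]
    exact ContinuousLinearMap.continuous_det.comp cDv
  have ifrob : Integrable (fun x => FluidPDE.frobeniusNormSq (fderiv ℝ v x)) volume :=
    integrable_frobeniusNormSq_fderiv (hv.of_le (by norm_cast)) hv1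
  have ig : Integrable g volume := integrable_det_fderiv (hv.of_le (by norm_cast)) hB₁ hv1
  -- cut-offs `φ_n = cutoff (n + 1)`
  obtain ⟨C, hC0, hC⟩ := exists_norm_fderiv_cutoff_le (E := EuclideanSpace ℝ (Fin 3))
  have hn1 : ∀ n : ℕ, (0 : ℝ) < n + 1 := fun n => by positivity
  have hid : ∀ n : ℕ, ∫ x, cutoff ((n : ℝ) + 1) x * g x =
      -∫ y, v y 0 * ⟪cross (gradient (fun z => v z 1) y) (gradient (fun z => v z 2) y),
        gradient (cutoff ((n : ℝ) + 1)) y⟫_ℝ := fun n =>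
    integral_mul_det_fderiv_eq hv (contDiff_cutoff _) (hasCompactSupport_cutoff (hn1 n))
  -- the left side tends to `∫ g`
  have hL : Tendsto (fun n : ℕ => ∫ x, cutoff ((n : ℝ) + 1) x * g x) atTop (𝓝 (∫ x, g x)) := by
    refine tendsto_integral_of_dominated_convergence (fun x => ‖g x‖)
      (fun n => (((contDiff_cutoff (n := 1) _).continuous).mul hgc).aestronglyMeasurable) ig.norm
      (fun n => Eventually.of_forall fun x => ?_) (Eventually.of_forall fun x => ?_)
    · rw [norm_mul, Real.norm_eq_abs]
      calc |cutoff ((n : ℝ) + 1) x| * ‖g x‖ ≤ 1 * ‖g x‖ := by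
            gcongr; exact abs_cutoff_le_one _ _
        _ = ‖g x‖ := one_mul _
    · simpa using (tendsto_cutoff_natCast_add_one x).mul_const (g x)
  -- the right side tends to `0`
  have hR : Tendsto (fun n : ℕ => -∫ y, v y 0 * ⟪cross (gradient (fun z => v z 1) y)
      (gradient (fun z => v z 2) y), gradient (cutoff ((n : ℝ) + 1)) y⟫_ℝ) atTop (𝓝 0) := by
    have hpt : ∀ (n : ℕ) y, ‖v y 0 * ⟪cross (gradient (fun z => v z 1) y) (gradient (fun z => v z 2) y),
        gradient (cutoff ((n : ℝ) + 1)) y⟫_ℝ‖ ≤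
        (1 / 2) * B * (C / ((n : ℝ) + 1)) * FluidPDE.frobeniusNormSq (fderiv ℝ v y) := by
      intro n y
      rw [Real.norm_eq_abs]
      refine (abs_mul_inner_cross_gradient_le (hdV y) _).trans ?_
      have hφ : ‖gradient (cutoff ((n : ℝ) + 1)) y‖ ≤ C / ((n : ℝ) + 1) := by
        rw [gradient, LinearIsometryEquiv.norm_map]; exact hC _ (hn1 n) y
      have hF0 : 0 ≤ FluidPDE.frobeniusNormSq (fderiv ℝ v y) := FluidPDE.frobeniusNormSq_nonneg _
      have h1 : 1 / 2 * ‖v y‖ * ‖gradient (cutoff ((n : ℝ) + 1)) y‖ ≤ 1 / 2 * B * (C / ((n : ℝ) + 1)) :=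
        mul_le_mul (mul_le_mul_of_nonneg_left (hB y) (by norm_num)) hφ (norm_nonneg _) (by positivity)
      exact mul_le_mul_of_nonneg_right h1 hF0
    have hbound : ∀ n : ℕ, ‖∫ y, v y 0 * ⟪cross (gradient (fun z => v z 1) y)
        (gradient (fun z => v z 2) y), gradient (cutoff ((n : ℝ) + 1)) y⟫_ℝ‖ ≤
        (1 / 2) * B * (C / ((n : ℝ) + 1)) * ∫ y, FluidPDE.frobeniusNormSq (fderiv ℝ v y) := by
      intro n
      have h2 : ∫ y, ‖v y 0 * ⟪cross (gradient (fun z => v z 1) y) (gradient (fun z => v z 2) y),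
          gradient (cutoff ((n : ℝ) + 1)) y⟫_ℝ‖ ≤
          ∫ y, (1 / 2) * B * (C / ((n : ℝ) + 1)) * FluidPDE.frobeniusNormSq (fderiv ℝ v y) :=
        integral_mono_of_nonneg (Eventually.of_forall fun y => norm_nonneg _)
          (ifrob.const_mul _) (Eventually.of_forall fun y => hpt n y)
      rw [integral_const_mul] at h2
      exact (norm_integral_le_integral_norm _).trans h2
    have h0 : Tendsto (fun n : ℕ => (1 / 2) * B * (C / ((n : ℝ) + 1)) *
        ∫ y, FluidPDE.frobeniusNormSq (fderiv ℝ v y)) atTop (𝓝 0) := by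
      have h' : Tendsto (fun n : ℕ => C / ((n : ℝ) + 1)) atTop (𝓝 0) := by
        have := (tendsto_const_div_atTop_nhds_zero_nat C).comp (tendsto_add_atTop_nat 1)
        refine this.congr fun n => ?_
        simp [Function.comp, Nat.cast_succ]
      simpa using ((h'.const_mul ((1 / 2) * B)).mul_const (∫ y, FluidPDE.frobeniusNormSq (fderiv ℝ v y)))
    have h1 := squeeze_zero_norm hbound h0
    simpa using h1.neg
  -- conclude
  have hL' : Tendsto (fun n : ℕ => ∫ x, cutoff ((n : ℝ) + 1) x * g x) atTop (𝓝 0) := by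
    simp only [hid]; exact hR
  exact tendsto_nhds_unique hL hL'

end NullLagrangian

/-! ### The weighted key estimate `∫ φ ‖∂ⱼv‖² ≤ ‖φ‖_r ‖∂ⱼv‖₂^{2θ} (K‖D∂ⱼv‖₂)^{2(1-θ)}` -/

section KeyEstimate

/-- Exponent algebra (copy of the Beirão da Veiga bookkeeping): for `ρ > 3/2` and `m = 2ρ/(ρ-1)`,
`2 < m < 6`, `(ρ, m/2)` are Hölder conjugate, and the interpolation exponents between `L²` and
`L⁶` at `L^m`, times `2/m`, are `1 - 3/(2ρ)` and `1/(2ρ)`. [folklore] -/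
private theorem miller_exponent_algebra {ρ : ℝ} (hρ : 3 / 2 < ρ) :
    let m : ℝ := 2 * ρ / (ρ - 1)
    2 < m ∧ m < 6 ∧ ρ.HolderConjugate (m / 2) ∧
      (6 - m) / (6 - 2) * (2 / m) = 1 - 3 / (2 * ρ) ∧ (m - 2) / (6 - 2) * (2 / m) = 1 / (2 * ρ) := by
  intro m
  have hρ1 : 0 < ρ - 1 := by linarith
  have hρ0 : 0 < ρ := by linarith
  have hm : m = 2 * ρ / (ρ - 1) := rfl
  refine ⟨?_, ?_, ?_, ?_, ?_⟩
  · rw [hm, lt_div_iff₀ hρ1]; linarith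
  · rw [hm, div_lt_iff₀ hρ1]; linarith
  · rw [Real.holderConjugate_iff]
    refine ⟨by linarith, ?_⟩
    rw [hm]; field_simp; ring
  · rw [hm]; field_simp; ring
  · rw [hm]; field_simp; ring

/-- **The weighted key estimate** (the interpolation step of Miller 2020, proof of Thm. 1.1 / 5.2:
`∫ λ₂⁺|S|² ≤ ‖λ₂⁺‖_q ‖S‖²_{2q'}`, `‖S‖_{2q'} ≤ ‖S‖₂^θ ‖S‖₆^{1-θ}`, Sobolev). For a `C³` field
`v` on `ℝ³` with `Dv, D²v ∈ L²`, a continuous weight `0 ≤ φ ≤ B_φ` with `∫ φ^r < ∞`,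
`3/2 < r < ∞`, and the slice `vⱼ = ∂ⱼv`:
`∫ φ ‖vⱼ‖² ≤ (∫ φ^r)^{1/r} (∫ ‖vⱼ‖²)^{1-3/(2r)} (K² Σᵢ ∫ ‖∂ᵢvⱼ‖²)^{3/(2r)}`
(Hölder `(r, m/2)`, `m = 2r/(r-1)`, interpolation of `∫‖vⱼ‖^m` between `2` and `6`, Sobolev
`‖vⱼ‖₆ ≤ K‖Dvⱼ‖₂`). [cite: Miller2019, Thm 1.1 (proof of Thm 5.2)] -/
theorem integral_weight_mul_sq_norm_fderiv_apply_le
    {v : EuclideanSpace ℝ (Fin 3) → EuclideanSpace ℝ (Fin 3)} (hv : ContDiff ℝ 3 v)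
    (hv1 : ∫⁻ x, ‖iteratedFDeriv ℝ 1 v x‖ₑ ^ 2 < ⊤) (hv2 : ∫⁻ x, ‖iteratedFDeriv ℝ 2 v x‖ₑ ^ 2 < ⊤)
    {φ : EuclideanSpace ℝ (Fin 3) → ℝ} (hφc : Continuous φ) (hφ0 : ∀ x, 0 ≤ φ x)
    {Bφ : ℝ} (hφB : ∀ x, φ x ≤ Bφ) {r : ℝ} (hr : 3 / 2 < r)
    (hφr : ∫⁻ x, ENNReal.ofReal (φ x) ^ r < ⊤) (j : Fin 3) :
    ∫ x, φ x * ‖fderiv ℝ v x (EuclideanSpace.basisFun (Fin 3) ℝ j)‖ ^ 2 ≤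
      ((∫⁻ x, ENNReal.ofReal (φ x) ^ r) ^ (1 / r)).toReal *
        (∫ x, ‖fderiv ℝ v x (EuclideanSpace.basisFun (Fin 3) ℝ j)‖ ^ 2) ^ (1 - 3 / (2 * r)) *
        ((SNormLESNormFDerivOfEqConst (EuclideanSpace ℝ (Fin 3))
            (volume : Measure (EuclideanSpace ℝ (Fin 3))) 2 : ℝ) ^ 2 *
          ∑ i, ∫ x, ‖fderiv ℝ (fun y => fderiv ℝ v y (EuclideanSpace.basisFun (Fin 3) ℝ j)) x
            (EuclideanSpace.basisFun (Fin 3) ℝ i)‖ ^ 2) ^ (3 / (2 * r)) := by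
  set e := EuclideanSpace.basisFun (Fin 3) ℝ with he
  set K : ℝ≥0 := SNormLESNormFDerivOfEqConst (EuclideanSpace ℝ (Fin 3))
    (volume : Measure (EuclideanSpace ℝ (Fin 3))) 2 with hK
  have hρ0 : 0 < r := by linarith
  obtain ⟨h2m, hm6, hconj, hexpθ, hexp1⟩ := miller_exponent_algebra hr
  set m : ℝ := 2 * r / (r - 1) with hm
  have hm0 : 0 < m := by linarith
  have hBφ0 : 0 ≤ Bφ := (hφ0 0).trans (hφB 0)
  -- the slice `vⱼ = ∂ⱼ v` and the second slices
  set vs : EuclideanSpace ℝ (Fin 3) → EuclideanSpace ℝ (Fin 3) := fun y => fderiv ℝ v y (e j) with hvs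
  have hvs2 : ContDiff ℝ 2 vs := (hv.fderiv_right (m := 2) (by norm_num)).clm_apply contDiff_const
  have hvs1 : ContDiff ℝ 1 vs := hvs2.of_le (by norm_num)
  have cvs : Continuous vs := hvs1.continuous
  have cdvs : ∀ i, Continuous fun x => fderiv ℝ vs x (e i) := fun i =>
    (hvs1.continuous_fderiv one_ne_zero).clm_apply continuous_const
  have n_vs : ∀ x, ‖vs x‖ ≤ ‖iteratedFDeriv ℝ 1 v x‖ := fun x => norm_fderiv_apply_basisFun_le v x j
  have n_dvs : ∀ i x, ‖fderiv ℝ vs x (e i)‖ ≤ ‖iteratedFDeriv ℝ 2 v x‖ := fun i x =>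
    (norm_fderiv_apply_basisFun_le vs x i).trans
      (norm_iteratedFDeriv_fderiv_apply_basisFun_le hv 1 (by norm_num) x j)
  have l2vs : ∫⁻ x, ‖vs x‖ₑ ^ 2 < ⊤ := lintegral_enorm_sq_lt_top_of_norm_le n_vs hv1
  have l2dvs : ∀ i, ∫⁻ x, ‖fderiv ℝ vs x (e i)‖ₑ ^ 2 < ⊤ := fun i =>
    lintegral_enorm_sq_lt_top_of_norm_le (n_dvs i) hv2
  -- the real quantities
  have i_a : Integrable (fun x => ‖vs x‖ ^ 2) volume :=
    FluidPDE.integrable_sq_norm_of_lintegral_lt_top cvs l2vs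
  have i_dd : ∀ i, Integrable (fun x => ‖fderiv ℝ vs x (e i)‖ ^ 2) volume := fun i =>
    FluidPDE.integrable_sq_norm_of_lintegral_lt_top (cdvs i) (l2dvs i)
  set a : ℝ := ∫ x, ‖vs x‖ ^ 2 with ha
  set R : ℝ := ∑ i, ∫ x, ‖fderiv ℝ vs x (e i)‖ ^ 2 with hR
  have ha0 : 0 ≤ a := integral_nonneg fun x => sq_nonneg _
  have hR0 : 0 ≤ R := Finset.sum_nonneg fun i _ => integral_nonneg fun x => sq_nonneg _
  set g : EuclideanSpace ℝ (Fin 3) → ℝ := fun x => φ x * ‖vs x‖ ^ 2 with hg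
  have hg0 : ∀ x, 0 ≤ g x := fun x => mul_nonneg (hφ0 x) (sq_nonneg _)
  have hgm : AEStronglyMeasurable g volume := (hφc.mul (cvs.norm.pow 2)).aestronglyMeasurable
  have i_g : Integrable g volume := by
    have hdom : Integrable (fun x => Bφ * ‖vs x‖ ^ 2) volume := i_a.const_mul _
    refine hdom.mono' hgm (Eventually.of_forall fun x => ?_)
    rw [Real.norm_of_nonneg (hg0 x), hg]
    exact mul_le_mul_of_nonneg_right (hφB x) (sq_nonneg _)
  -- `ℝ≥0∞` versions
  have hA : ENNReal.ofReal a = ∫⁻ x, ‖vs x‖ₑ ^ (2 : ℝ) := by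
    rw [ha, ofReal_integral_eq_lintegral_ofReal i_a (Eventually.of_forall fun x => sq_nonneg _)]
    refine lintegral_congr fun x => ?_
    rw [← ofReal_norm, ENNReal.ofReal_rpow_of_nonneg (norm_nonneg _) (by norm_num), Real.rpow_two]
  have hD : eLpNorm (fderiv ℝ vs) 2 volume ^ 2 ≤ ENNReal.ofReal R := by
    rw [← lintegral_enorm_sq_eq_eLpNorm_two_sq, hR, ← integral_finsetSum _ fun i _ => i_dd i,
      ofReal_integral_eq_lintegral_ofReal (integrable_finsetSum _ fun i _ => i_dd i)
        (Eventually.of_forall fun x => Finset.sum_nonneg fun i _ => sq_nonneg _)]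
    refine lintegral_mono fun x => ?_
    rw [← ofReal_norm, ← ENNReal.ofReal_pow (norm_nonneg _)]
    exact ENNReal.ofReal_le_ofReal (FluidPDE.sq_opNorm_le_sum_sq_norm_apply e (fderiv ℝ vs x))
  have hP : ENNReal.ofReal (∫ x, g x) = ∫⁻ x, ENNReal.ofReal (φ x) * ‖vs x‖ₑ ^ (2 : ℝ) := by
    rw [ofReal_integral_eq_lintegral_ofReal i_g (Eventually.of_forall hg0)]
    refine lintegral_congr fun x => ?_
    rw [hg]
    dsimp only
    rw [ENNReal.ofReal_mul (hφ0 x), ← Real.rpow_two,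
      ← ENNReal.ofReal_rpow_of_nonneg (norm_nonneg _) (by norm_num), ofReal_norm]
  -- Sobolev: `∫⁻ ‖vⱼ‖ₑ⁶ ≤ (K² R)³`
  have hS : eLpNorm vs 6 volume ≤ K * eLpNorm (fderiv ℝ vs) 2 volume :=
    FluidPDE.eLpNorm_six_le_eLpNorm_fderiv_two volume finrank_euclideanSpace_fin hvs1
      (eLpNorm_two_lt_top_of_lintegral_enorm_sq_lt_top l2vs)
  have hS6 : ∫⁻ x, ‖vs x‖ₑ ^ (6 : ℝ) ≤ ((K : ℝ≥0∞) ^ 2 * ENNReal.ofReal R) ^ (3 : ℝ) := by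
    have h6 : ∫⁻ x, ‖vs x‖ₑ ^ (6 : ℝ) = eLpNorm vs 6 volume ^ (6 : ℝ) := by
      rw [eLpNorm_eq_lintegral_rpow_enorm_toReal (by norm_num) (by norm_num), ENNReal.toReal_ofNat,
        ← ENNReal.rpow_mul]
      norm_num
    rw [h6]
    calc eLpNorm vs 6 volume ^ (6 : ℝ) ≤ (K * eLpNorm (fderiv ℝ vs) 2 volume) ^ (6 : ℝ) := by gcongr
      _ = ((K : ℝ≥0∞) ^ 2 * eLpNorm (fderiv ℝ vs) 2 volume ^ 2) ^ (3 : ℝ) := by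
          rw [← mul_pow, ← ENNReal.rpow_natCast, ← ENNReal.rpow_mul]; norm_num
      _ ≤ ((K : ℝ≥0∞) ^ 2 * ENNReal.ofReal R) ^ (3 : ℝ) := by gcongr
  -- Hölder `(r, m/2)` and interpolation
  have hHolder : ∫⁻ x, ENNReal.ofReal (φ x) * ‖vs x‖ₑ ^ (2 : ℝ) ≤
      (∫⁻ x, ENNReal.ofReal (φ x) ^ r) ^ (1 / r) * (∫⁻ x, ‖vs x‖ₑ ^ m) ^ (2 / m) := by
    have h := ENNReal.lintegral_mul_le_Lp_mul_Lq volume hconj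
      (f := fun x => ENNReal.ofReal (φ x)) (g := fun x => ‖vs x‖ₑ ^ (2 : ℝ))
      (ENNReal.measurable_ofReal.comp_aemeasurable hφc.aemeasurable) (cvs.aemeasurable.enorm.pow_const _)
    have hgm' : ∀ x, (‖vs x‖ₑ ^ (2 : ℝ)) ^ (m / 2) = ‖vs x‖ₑ ^ m := fun x => by
      rw [← ENNReal.rpow_mul]; congr 1; field_simp
    simp only [Pi.mul_apply, hgm'] at h
    have e2 : 1 / (m / 2) = 2 / m := by field_simp
    rwa [e2] at h
  have hInterp : ∫⁻ x, ‖vs x‖ₑ ^ m ≤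
      (∫⁻ x, ‖vs x‖ₑ ^ (2 : ℝ)) ^ ((6 - m) / (6 - 2)) * (∫⁻ x, ‖vs x‖ₑ ^ (6 : ℝ)) ^ ((m - 2) / (6 - 2)) :=
    lintegral_rpow_interpolate cvs.aemeasurable.enorm zero_lt_two (by norm_num) h2m.le hm6.le
  -- assemble in `ℝ≥0∞`
  set N : ℝ≥0∞ := (∫⁻ x, ENNReal.ofReal (φ x) ^ r) ^ (1 / r) with hN
  have hNtop : N ≠ ⊤ := ENNReal.rpow_ne_top_of_nonneg (by positivity) hφr.ne
  have hcomb : ENNReal.ofReal (∫ x, g x) ≤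
      N * (ENNReal.ofReal a ^ (1 - 3 / (2 * r)) * ((K : ℝ≥0∞) ^ 2 * ENNReal.ofReal R) ^ (3 / (2 * r))) := by
    rw [hP]
    refine hHolder.trans ?_
    gcongr
    calc (∫⁻ x, ‖vs x‖ₑ ^ m) ^ (2 / m)
        ≤ ((∫⁻ x, ‖vs x‖ₑ ^ (2 : ℝ)) ^ ((6 - m) / (6 - 2)) *
            (∫⁻ x, ‖vs x‖ₑ ^ (6 : ℝ)) ^ ((m - 2) / (6 - 2))) ^ (2 / m) := by gcongr
      _ = (∫⁻ x, ‖vs x‖ₑ ^ (2 : ℝ)) ^ (1 - 3 / (2 * r)) * ((∫⁻ x, ‖vs x‖ₑ ^ (6 : ℝ)) ^ (1 / (2 * r))) := by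
          rw [ENNReal.mul_rpow_of_nonneg _ _ (by positivity), ← ENNReal.rpow_mul,
            ← ENNReal.rpow_mul, hexpθ, hexp1]
      _ ≤ (∫⁻ x, ‖vs x‖ₑ ^ (2 : ℝ)) ^ (1 - 3 / (2 * r)) *
            ((((K : ℝ≥0∞) ^ 2 * ENNReal.ofReal R) ^ (3 : ℝ)) ^ (1 / (2 * r))) := by gcongr
      _ = ENNReal.ofReal a ^ (1 - 3 / (2 * r)) * ((K : ℝ≥0∞) ^ 2 * ENNReal.ofReal R) ^ (3 / (2 * r)) := by
          rw [hA, ← ENNReal.rpow_mul]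
          congr 2; field_simp
  -- back to reals
  have h32 : 0 ≤ 1 - 3 / (2 * r) := by
    rw [sub_nonneg, div_le_one (by positivity)]; linarith
  have hfinR : N * (ENNReal.ofReal a ^ (1 - 3 / (2 * r)) *
      ((K : ℝ≥0∞) ^ 2 * ENNReal.ofReal R) ^ (3 / (2 * r))) ≠ ⊤ := by
    refine ENNReal.mul_ne_top hNtop (ENNReal.mul_ne_top ?_ ?_)
    · exact ENNReal.rpow_ne_top_of_nonneg h32 ENNReal.ofReal_ne_top
    · exact ENNReal.rpow_ne_top_of_nonneg (by positivity)
        (ENNReal.mul_ne_top (ENNReal.pow_ne_top ENNReal.coe_ne_top) ENNReal.ofReal_ne_top)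
  have := (ENNReal.ofReal_le_iff_le_toReal hfinR).1 hcomb
  refine this.trans_eq ?_
  rw [ENNReal.toReal_mul, ENNReal.toReal_mul, ← ENNReal.toReal_rpow, ← ENNReal.toReal_rpow,
    ← ENNReal.toReal_rpow, ENNReal.toReal_mul, ENNReal.toReal_pow, ENNReal.toReal_ofReal ha0,
    ENNReal.toReal_ofReal hR0, ENNReal.coe_toReal, mul_assoc]

end KeyEstimate

/-! ### The slice estimate: enstrophy production bounded by the middle principal strain -/

section Slice

/-- Young absorption (the Beirão da Veiga bookkeeping, private to its file, copied): for
`0 < θ < 1`, `ν > 0`, `N, K, a, R ≥ 0`, `P ≤ N a^θ (K² R)^{1-θ}` implies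
`P ≤ (ν/2) R + θ (2(1-θ))^{(1-θ)/θ} ν^{-(1-θ)/θ} (N K^{2(1-θ)})^{1/θ} a`. [folklore] -/
private theorem miller_absorb_component {θ ν N K P a R : ℝ} (hθ0 : 0 < θ) (hθ1 : θ < 1)
    (hν : 0 < ν) (hN : 0 ≤ N) (hK : 0 ≤ K) (ha : 0 ≤ a) (hR : 0 ≤ R)
    (hP : P ≤ N * a ^ θ * (K ^ 2 * R) ^ (1 - θ)) :
    P ≤ ν / 2 * R +
      θ * (2 * (1 - θ)) ^ ((1 - θ) / θ) * ν ^ (-((1 - θ) / θ)) *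
        (N * K ^ (2 * (1 - θ))) ^ (1 / θ) * a := by
  set A : ℝ := N * K ^ (2 * (1 - θ)) with hAdef
  have hA0 : 0 ≤ A := by positivity
  have h1 : P ≤ A * a ^ θ * R ^ (1 - θ) := by
    have hKR : (K ^ 2 * R) ^ (1 - θ) = K ^ (2 * (1 - θ)) * R ^ (1 - θ) := by
      rw [Real.mul_rpow (sq_nonneg _) hR, ← Real.rpow_natCast K 2, ← Real.rpow_mul hK]
      norm_num
    calc P ≤ N * a ^ θ * (K ^ 2 * R) ^ (1 - θ) := hP
      _ = A * a ^ θ * R ^ (1 - θ) := by rw [hKR, hAdef]; ring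
  exact h1.trans (mul_rpow_mul_rpow_le_absorb hθ0 hθ1 hν hA0 hR ha)

/-- Constant bookkeeping (copy of the private Beirão da Veiga identity):
`θ (2(1-θ))^{(1-θ)/θ} ν^{-(1-θ)/θ} (N K^{2(1-θ)})^{1/θ} = C(θ) ν^{1-1/θ} N^{1/θ}`,
`C(θ) = θ (2(1-θ))^{(1-θ)/θ} K^{2(1-θ)/θ}`. [folklore] -/
private theorem miller_const_identity {θ ν N K : ℝ} (hθ0 : 0 < θ) (hN : 0 ≤ N) (hK : 0 ≤ K) :
    θ * (2 * (1 - θ)) ^ ((1 - θ) / θ) * ν ^ (-((1 - θ) / θ)) * (N * K ^ (2 * (1 - θ))) ^ (1 / θ) =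
      (θ * (2 * (1 - θ)) ^ ((1 - θ) / θ) * K ^ (2 * (1 - θ) / θ)) * ν ^ (1 - 1 / θ) * N ^ (1 / θ) := by
  have hsplit : (N * K ^ (2 * (1 - θ))) ^ (1 / θ) = N ^ (1 / θ) * K ^ (2 * (1 - θ) / θ) := by
    rw [Real.mul_rpow hN (Real.rpow_nonneg hK _), ← Real.rpow_mul hK]
    have hKexp : 2 * (1 - θ) * (1 / θ) = 2 * (1 - θ) / θ := by field_simp
    rw [hKexp]
  have hνpow : ν ^ (-((1 - θ) / θ)) = ν ^ (1 - 1 / θ) := by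
    congr 1
    field_simp
    ring
  rw [hsplit, hνpow]
  ring
set_option maxHeartbeats 400000 in -- buildfix (bf3-g25): 160k/180k FAIL, 200k PASS at accept time; line-neutral budget line
/-- **The enstrophy production bound by the middle principal strain** (Miller 2019, proof of
Thm. 1.1 = Thm. 5.2, arXiv pp. 16–17, with the priority of Neustupa–Penel 2001: the bound
`∂ₜ‖S‖² ≤ -‖S‖²_{Ḣ¹} + 2∫ λ₂⁺|S|²` followed by Hölder `(q, q')`, interpolation of `L^{2q'}`
between `L²` and `L⁶`, Sobolev, and Young with `b = 2q/3`). Let `v : ℝ³ → ℝ³` be smooth and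
divergence free, `W : ℝ³ → ℝ³` and `q : ℝ³ → ℝ` be `C¹`, with the momentum equation
`W + (v·∇)v = νΔv - ∇q` (`ν > 0`), `v` and `Dv` bounded (integrability), `Dv, D²v, D³v, W, DW,
q, Dq ∈ L²`. Let `m ≥ 0` be a pointwise majorant of the middle principal strain `λ₂(Dv(x))` in
the two-frame Courant–Fischer form, with `∫ m^r < ∞`, `3/2 < r < ∞`, `θ = 1 - 3/(2r)`
(`p = 1/θ = 2r/(2r-3)`, `2/p + 3/r = 2`). Then
`∫ Σᵢ ⟪∂ᵢv, ∂ᵢW⟫ ≤ C(θ) 2^{1/θ} ν^{1-1/θ} ((∫ m^r)^{1/r})^{1/θ} ∫ |∇v|²_F`,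
`C(θ) = θ (2(1-θ))^{(1-θ)/θ} K^{2(1-θ)/θ}`.
Proof: `∫ Σᵢ⟪∂ᵢv, ∂ᵢW⟫ = -ν‖Δv‖²₂ + ∫⟪Δv, (v·∇)v⟫` (pressure term vanishes),
`∫⟪Δv, (v·∇)v⟫ = -Σⱼ∫⟪∂ⱼv, Dv ∂ⱼv⟫` (`integral_inner_laplacian_convect_eq_neg_sum`)
`≤ ∫ (2 λ₂⁺(Dv) |Dv|²_F + det Dv)` pointwise (`neg_sum_inner_apply_apply_le_midStrain`, Miller's
Lemma 5.1) with `∫ det Dv = 0` (`integral_det_fderiv_eq_zero`); then per component the weighted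
key estimate `integral_weight_mul_sq_norm_fderiv_apply_le` with the continuous weight
`λ₂⁺ ∘ Dv ≤ m`, Young absorption of half the dissipation, and `Σⱼ Σᵢ ‖∂ᵢ∂ⱼv‖²₂ = ‖Δv‖²₂`.
[cite: Miller2019, Thm 1.1 (proof of Thm 5.2)] [cite: NeustupaPenel2001, Thm 2] -/
theorem integral_sum_inner_fderiv_le_of_momentum_of_midStrain {ν : ℝ} (hν : 0 < ν)
    {v W : EuclideanSpace ℝ (Fin 3) → EuclideanSpace ℝ (Fin 3)} {q : EuclideanSpace ℝ (Fin 3) → ℝ}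
    (hv : ContDiff ℝ ∞ v) (hW : ContDiff ℝ 1 W) (hq : ContDiff ℝ 1 q)
    (hmom : ∀ x, W x + FluidPDE.convect v v x = ν • (Δ v) x - gradient q x)
    (hdiv : VectorCalculus.IsDivFree v) {B : ℝ} (hB : ∀ x, ‖v x‖ ≤ B)
    {B₁ : ℝ} (hB₁ : ∀ x, ‖fderiv ℝ v x‖ ≤ B₁)
    {r : ℝ} (hr : 3 / 2 < r) {θ : ℝ} (hθ : θ = 1 - 3 / (2 * r))
    {m : EuclideanSpace ℝ (Fin 3) → ℝ} (hm0 : ∀ x, 0 ≤ m x)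
    (hmaj : ∀ x, ∃ y z : EuclideanSpace ℝ (Fin 3), ‖y‖ = 1 ∧ ‖z‖ = 1 ∧ ⟪y, z⟫ = 0 ∧
      ∀ α β : ℝ, ⟪fderiv ℝ v x (α • y + β • z), α • y + β • z⟫ ≤ m x * (α ^ 2 + β ^ 2))
    (hmr : ∫⁻ x, ENNReal.ofReal (m x) ^ r < ⊤)
    (hv1 : ∫⁻ x, ‖iteratedFDeriv ℝ 1 v x‖ₑ ^ 2 < ⊤) (hv2 : ∫⁻ x, ‖iteratedFDeriv ℝ 2 v x‖ₑ ^ 2 < ⊤)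
    (hv3 : ∫⁻ x, ‖iteratedFDeriv ℝ 3 v x‖ₑ ^ 2 < ⊤)
    (hW0 : ∫⁻ x, ‖W x‖ₑ ^ 2 < ⊤) (hW1 : ∫⁻ x, ‖iteratedFDeriv ℝ 1 W x‖ₑ ^ 2 < ⊤)
    (hq0 : ∫⁻ x, ‖q x‖ₑ ^ 2 < ⊤) (hq1 : ∫⁻ x, ‖iteratedFDeriv ℝ 1 q x‖ₑ ^ 2 < ⊤) :
    ∫ x, ∑ i, ⟪fderiv ℝ v x (EuclideanSpace.basisFun (Fin 3) ℝ i),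
        fderiv ℝ W x (EuclideanSpace.basisFun (Fin 3) ℝ i)⟫ ≤
      (θ * (2 * (1 - θ)) ^ ((1 - θ) / θ) *
          (SNormLESNormFDerivOfEqConst (EuclideanSpace ℝ (Fin 3))
            (volume : Measure (EuclideanSpace ℝ (Fin 3))) 2 : ℝ) ^ (2 * (1 - θ) / θ) *
          (2 : ℝ) ^ (1 / θ)) *
        ν ^ (1 - 1 / θ) * ((∫⁻ x, ENNReal.ofReal (m x) ^ r) ^ (1 / r)).toReal ^ (1 / θ) *
        ∫ x, FluidPDE.frobeniusNormSq (fderiv ℝ v x) := by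
  set e := EuclideanSpace.basisFun (Fin 3) ℝ with he
  have he1 : ∀ i, ‖e i‖ = 1 := fun i => by simp [he]
  set K : ℝ≥0 := SNormLESNormFDerivOfEqConst (EuclideanSpace ℝ (Fin 3))
    (volume : Measure (EuclideanSpace ℝ (Fin 3))) 2 with hK
  set Nm : ℝ := ((∫⁻ x, ENNReal.ofReal (m x) ^ r) ^ (1 / r)).toReal with hNmdef
  have hNm0 : 0 ≤ Nm := ENNReal.toReal_nonneg
  have hB0 : 0 ≤ B := (norm_nonneg _).trans (hB 0)
  have hB₁0 : 0 ≤ B₁ := (norm_nonneg _).trans (hB₁ 0)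
  -- the exponent `θ ∈ (0, 1)`
  have hρ0 : 0 < r := by linarith
  have hθ0 : 0 < θ := by
    rw [hθ, sub_pos, div_lt_one (by positivity)]; linarith
  have hθ1 : θ < 1 := by
    rw [hθ]; linarith [div_pos (zero_lt_three' ℝ) (by positivity : (0 : ℝ) < 2 * r)]
  -- smoothness and continuity
  have hv3' : ContDiff ℝ 3 v := hv.of_le (by norm_cast)
  have hv2' : ContDiff ℝ 2 v := hv.of_le (by norm_cast)
  have hv1' : ContDiff ℝ 1 v := hv.of_le (by norm_cast)
  have hdV : ∀ y, DifferentiableAt ℝ v y := fun y => (hv.differentiable (by simp)) y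
  have hΔ1 : ContDiff ℝ 1 (Δ v) := contDiff_one_laplacian_of_contDiff_three hv3'
  have cv : Continuous v := hv.continuous
  have cDv : Continuous (fderiv ℝ v) := hv.continuous_fderiv (by simp)
  have cD2 : Continuous fun x => iteratedFDeriv ℝ 2 v x := hv.continuous_iteratedFDeriv (by norm_cast)
  have cD3 : Continuous fun x => iteratedFDeriv ℝ 3 v x := hv.continuous_iteratedFDeriv (by norm_cast)
  have cdiv : ∀ i, Continuous fun x => fderiv ℝ v x (e i) := fun i => cDv.clm_apply continuous_const
  have cdvs : ∀ j i, Continuous fun x => fderiv ℝ (fun y => fderiv ℝ v y (e j)) x (e i) := fun j i =>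
    ((((hv3'.fderiv_right (m := 2) (by norm_num)).clm_apply contDiff_const).continuous_fderiv
      (by norm_num)).clm_apply continuous_const)
  have cW : Continuous W := hW.continuous
  have cDW : Continuous (fderiv ℝ W) := hW.continuous_fderiv one_ne_zero
  have cdiW : ∀ i, Continuous fun x => fderiv ℝ W x (e i) := fun i => cDW.clm_apply continuous_const
  have cq : Continuous q := hq.continuous
  have cDq : Continuous (fderiv ℝ q) := hq.continuous_fderiv one_ne_zero
  have cdiq : ∀ i, Continuous fun x => fderiv ℝ q x (e i) := fun i => cDq.clm_apply continuous_const
  have cgq : Continuous (gradient q) := by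
    have : gradient q = fun x => (InnerProductSpace.toDual ℝ _).symm (fderiv ℝ q x) := rfl
    rw [this]
    exact (InnerProductSpace.toDual ℝ (EuclideanSpace ℝ (Fin 3))).symm.continuous.comp cDq
  have cΔ : Continuous (Δ v) := hΔ1.continuous
  have cdΔ : ∀ i, Continuous fun x => fderiv ℝ (Δ v) x (e i) := fun i =>
    (hΔ1.continuous_fderiv one_ne_zero).clm_apply continuous_const
  have cconv : Continuous (FluidPDE.convect v v) := cDv.clm_apply cv
  have c3D2 : Continuous fun x => (3 : ℝ) • iteratedFDeriv ℝ 2 v x := cD2.const_smul (3 : ℝ)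
  have c3D3 : Continuous fun x => (3 : ℝ) • iteratedFDeriv ℝ 3 v x := cD3.const_smul (3 : ℝ)
  have cBDv : Continuous fun x => B • fderiv ℝ v x := cDv.const_smul B
  -- the weight `φ = λ₂⁺ ∘ Dv`: continuous, `0 ≤ φ ≤ B₁`, `φ ≤ m`
  set φ : EuclideanSpace ℝ (Fin 3) → ℝ := fun x =>
    max (strainEigenvalues (fderiv ℝ v x : EuclideanSpace ℝ (Fin 3) →ₗ[ℝ] EuclideanSpace ℝ (Fin 3))
      finrank_euclideanSpace_fin 1) 0 with hφdef
  have hφc : Continuous φ := (lipschitzWith_midStrain.continuous.comp cDv).max continuous_const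
  have hφ0 : ∀ x, 0 ≤ φ x := fun x => le_max_right _ _
  have hφB : ∀ x, φ x ≤ B₁ := fun x =>
    max_le ((midStrain_le_opNorm _).trans (hB₁ x)) ((norm_nonneg _).trans (hB₁ x))
  have hφm : ∀ x, φ x ≤ m x := by
    intro x
    refine max_le ?_ (hm0 x)
    obtain ⟨y, z, hy, hz, hyz, h⟩ := hmaj x
    exact (strainEigenvalues_mid_le_iff
      (fderiv ℝ v x : EuclideanSpace ℝ (Fin 3) →ₗ[ℝ] EuclideanSpace ℝ (Fin 3))
      finrank_euclideanSpace_fin (m x)).2 ⟨y, z, hy, hz, hyz, fun α β => by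
        simpa only [ContinuousLinearMap.coe_coe] using h α β⟩
  have hφm_r : ∫⁻ x, ENNReal.ofReal (φ x) ^ r ≤ ∫⁻ x, ENNReal.ofReal (m x) ^ r :=
    lintegral_mono fun x => ENNReal.rpow_le_rpow (ENNReal.ofReal_le_ofReal (hφm x)) hρ0.le
  have hφr : ∫⁻ x, ENNReal.ofReal (φ x) ^ r < ⊤ := lt_of_le_of_lt hφm_r hmr
  set Nφ : ℝ := ((∫⁻ x, ENNReal.ofReal (φ x) ^ r) ^ (1 / r)).toReal with hNφdef
  have hNφ0 : 0 ≤ Nφ := ENNReal.toReal_nonneg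
  have hNφNm : Nφ ≤ Nm := by
    rw [hNφdef, hNmdef]
    refine ENNReal.toReal_mono ?_ (ENNReal.rpow_le_rpow hφm_r (by positivity))
    exact ENNReal.rpow_ne_top_of_nonneg (by positivity) hmr.ne
  -- pointwise norm bounds
  have hDv_eq : ∀ x, ‖fderiv ℝ v x‖ = ‖iteratedFDeriv ℝ 1 v x‖ := fun x => by
    rw [← norm_iteratedFDeriv_fderiv, norm_iteratedFDeriv_zero]
  have n_Δ : ∀ x, ‖(Δ v) x‖ ≤ ‖(3 : ℝ) • iteratedFDeriv ℝ 2 v x‖ := fun x => by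
    rw [norm_smul, Real.norm_of_nonneg (by norm_num : (0 : ℝ) ≤ 3)]
    exact norm_laplacian_le_three_mul_norm_iteratedFDeriv_two hv2' x
  have n_dΔ : ∀ i x, ‖fderiv ℝ (Δ v) x (e i)‖ ≤ ‖(3 : ℝ) • iteratedFDeriv ℝ 3 v x‖ := fun i x => by
    rw [norm_smul, Real.norm_of_nonneg (by norm_num : (0 : ℝ) ≤ 3),
      fderiv_laplacian_apply_of_contDiff_three hv3' x (e i)]
    exact (norm_laplacian_le_three_mul_norm_iteratedFDeriv_two
      ((hv3'.fderiv_right (m := 2) (by norm_num)).clm_apply contDiff_const) x).trans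
      (mul_le_mul_of_nonneg_left (norm_iteratedFDeriv_fderiv_apply_basisFun_le hv3' 2 (by norm_num) x i)
        (by norm_num))
  have n_conv : ∀ x, ‖FluidPDE.convect v v x‖ ≤ ‖B • fderiv ℝ v x‖ := fun x => by
    rw [FluidPDE.convect, norm_smul, Real.norm_of_nonneg hB0, mul_comm]
    exact (fderiv ℝ v x).le_opNorm_of_le (hB x)
  have n_gq : ∀ x, ‖gradient q x‖ = ‖iteratedFDeriv ℝ 1 q x‖ := fun x => by
    rw [gradient, LinearIsometryEquiv.norm_map, ← norm_iteratedFDeriv_fderiv, norm_iteratedFDeriv_zero]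
  have hin : ∀ i (y : EuclideanSpace ℝ (Fin 3)), ‖⟪e i, y⟫‖ ≤ ‖y‖ := fun i y =>
    (norm_inner_le_norm (𝕜 := ℝ) (e i) y).trans (by rw [he1, one_mul])
  -- finite `L²` norms
  have l2Dv : ∫⁻ x, ‖fderiv ℝ v x‖ₑ ^ 2 < ⊤ :=
    lintegral_enorm_sq_lt_top_of_norm_le (fun x => (hDv_eq x).le) hv1
  have l2smul3 : ∀ {n : ℕ}, ∫⁻ x, ‖iteratedFDeriv ℝ n v x‖ₑ ^ 2 < ⊤ →
      ∫⁻ x, ‖(3 : ℝ) • iteratedFDeriv ℝ n v x‖ₑ ^ 2 < ⊤ := by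
    intro n h
    have : ∀ x, ‖(3 : ℝ) • iteratedFDeriv ℝ n v x‖ₑ ^ 2 =
        ENNReal.ofReal (3 ^ 2) * ‖iteratedFDeriv ℝ n v x‖ₑ ^ 2 := by
      intro x
      rw [enorm_smul, mul_pow, Real.enorm_eq_ofReal (by norm_num : (0:ℝ) ≤ 3),
        ENNReal.ofReal_pow (by norm_num : (0:ℝ) ≤ 3)]
    simp_rw [this]
    rw [lintegral_const_mul' _ _ ENNReal.ofReal_ne_top]
    exact ENNReal.mul_lt_top ENNReal.ofReal_lt_top h
  have l2Δ : ∫⁻ x, ‖(3 : ℝ) • iteratedFDeriv ℝ 2 v x‖ₑ ^ 2 < ⊤ := l2smul3 hv2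
  have l2dΔ : ∫⁻ x, ‖(3 : ℝ) • iteratedFDeriv ℝ 3 v x‖ₑ ^ 2 < ⊤ := l2smul3 hv3
  have l2BDv : ∫⁻ x, ‖B • fderiv ℝ v x‖ₑ ^ 2 < ⊤ := by
    have : ∀ x, ‖B • fderiv ℝ v x‖ₑ ^ 2 = ‖B‖ₑ ^ 2 * ‖fderiv ℝ v x‖ₑ ^ 2 := fun x => by
      rw [enorm_smul, mul_pow]
    simp_rw [this]
    rw [lintegral_const_mul' _ _ (by simp)]
    exact ENNReal.mul_lt_top (by simp) l2Dv
  have l2gq : ∫⁻ x, ‖gradient q x‖ₑ ^ 2 < ⊤ :=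
    lintegral_enorm_sq_lt_top_of_norm_le (fun x => (n_gq x).le) hq1
  have l2diq : ∀ i, ∫⁻ x, ‖fderiv ℝ q x (e i)‖ₑ ^ 2 < ⊤ := fun i =>
    lintegral_enorm_sq_lt_top_of_norm_le (fun x => norm_fderiv_apply_basisFun_le q x i) hq1
  have l2div : ∀ i, ∫⁻ x, ‖fderiv ℝ v x (e i)‖ₑ ^ 2 < ⊤ := fun i =>
    lintegral_enorm_sq_lt_top_of_norm_le (fun x => by
      simpa [he1] using (fderiv ℝ v x).le_opNorm (e i)) l2Dv
  have l2diW : ∀ i, ∫⁻ x, ‖fderiv ℝ W x (e i)‖ₑ ^ 2 < ⊤ := fun i =>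
    lintegral_enorm_sq_lt_top_of_norm_le (fun x => norm_fderiv_apply_basisFun_le W x i) hW1
  have l2ddv : ∀ i, ∫⁻ x, ‖fderiv ℝ (fun y => fderiv ℝ v y (e i)) x (e i)‖ₑ ^ 2 < ⊤ := fun i =>
    lintegral_enorm_sq_lt_top_of_norm_le (fun x => norm_fderiv_fderiv_apply_basisFun_le hv2' x i) hv2
  have l2dvs : ∀ j i, ∫⁻ x, ‖fderiv ℝ (fun y => fderiv ℝ v y (e j)) x (e i)‖ₑ ^ 2 < ⊤ := fun j i =>
    lintegral_enorm_sq_lt_top_of_norm_le (fun x =>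
      (norm_fderiv_apply_basisFun_le (fun y => fderiv ℝ v y (e j)) x i).trans
        (norm_iteratedFDeriv_fderiv_apply_basisFun_le hv3' 1 (by norm_num) x j)) hv2
  -- integrability of the products
  have i1 : ∀ i, Integrable (fun x => ⟪fderiv ℝ (fun y => fderiv ℝ v y (e i)) x (e i), W x⟫)
      volume := fun i =>
    integrable_of_norm_le_mul_of_lintegral_sq ((cdvs i i).inner cW).aestronglyMeasurable (cdvs i i) cW
      (l2ddv i) hW0 fun x => norm_inner_le_norm _ _
  have i2 : ∀ i, Integrable (fun x => ⟪fderiv ℝ v x (e i), fderiv ℝ W x (e i)⟫) volume := fun i =>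
    integrable_of_norm_le_mul_of_lintegral_sq ((cdiv i).inner (cdiW i)).aestronglyMeasurable
      (cdiv i) (cdiW i) (l2div i) (l2diW i) fun x => norm_inner_le_norm _ _
  have i3 : ∀ i, Integrable (fun x => ⟪fderiv ℝ v x (e i), W x⟫) volume := fun i =>
    integrable_of_norm_le_mul_of_lintegral_sq ((cdiv i).inner cW).aestronglyMeasurable (cdiv i) cW
      (l2div i) hW0 fun x => norm_inner_le_norm _ _
  have iΔΔ : Integrable (fun x => ‖(Δ v) x‖ ^ 2) volume :=
    FluidPDE.integrable_sq_norm_of_lintegral_lt_top cΔ (lintegral_enorm_sq_lt_top_of_norm_le n_Δ l2Δ)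
  have iΔg : Integrable (fun x => ⟪(Δ v) x, gradient q x⟫) volume :=
    integrable_of_norm_le_mul_of_lintegral_sq (cΔ.inner cgq).aestronglyMeasurable c3D2 cgq
      l2Δ l2gq fun x => (norm_inner_le_norm _ _).trans
        (mul_le_mul_of_nonneg_right (n_Δ x) (norm_nonneg _))
  have iΔc : Integrable (fun x => ⟪(Δ v) x, FluidPDE.convect v v x⟫) volume :=
    integrable_of_norm_le_mul_of_lintegral_sq (cΔ.inner cconv).aestronglyMeasurable c3D2 cBDv
      l2Δ l2BDv fun x => (norm_inner_le_norm _ _).trans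
        (mul_le_mul (n_Δ x) (n_conv x) (norm_nonneg _) (norm_nonneg _))
  have ifrob : Integrable (fun x => FluidPDE.frobeniusNormSq (fderiv ℝ v x)) volume :=
    integrable_frobeniusNormSq_fderiv hv1' hv1
  have idet : Integrable (fun x => LinearMap.det
      (fderiv ℝ v x : EuclideanSpace ℝ (Fin 3) →ₗ[ℝ] EuclideanSpace ℝ (Fin 3))) volume :=
    integrable_det_fderiv hv1' hB₁ hv1
  -- the per-component real quantities
  have i_a : ∀ j, Integrable (fun x => ‖fderiv ℝ v x (e j)‖ ^ 2) volume := fun j =>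
    FluidPDE.integrable_sq_norm_of_lintegral_lt_top (cdiv j) (l2div j)
  have i_φa : ∀ j, Integrable (fun x => φ x * ‖fderiv ℝ v x (e j)‖ ^ 2) volume := by
    intro j
    have hdom : Integrable (fun x => B₁ * ‖fderiv ℝ v x (e j)‖ ^ 2) volume := (i_a j).const_mul _
    refine hdom.mono' (hφc.mul ((cdiv j).norm.pow 2)).aestronglyMeasurable
      (Eventually.of_forall fun x => ?_)
    rw [Real.norm_of_nonneg (mul_nonneg (hφ0 x) (sq_nonneg _))]
    exact mul_le_mul_of_nonneg_right (hφB x) (sq_nonneg _)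
  have i_φF : Integrable (fun x => 2 * φ x * FluidPDE.frobeniusNormSq (fderiv ℝ v x)) volume := by
    have hdom : Integrable (fun x => (2 * B₁) * FluidPDE.frobeniusNormSq (fderiv ℝ v x)) volume :=
      ifrob.const_mul _
    refine hdom.mono' ((continuous_const.mul hφc).mul
      (FluidPDE.continuous_frobeniusNormSq_fderiv hv1' (by simp))).aestronglyMeasurable
      (Eventually.of_forall fun x => ?_)
    have hF0 : 0 ≤ FluidPDE.frobeniusNormSq (fderiv ℝ v x) := FluidPDE.frobeniusNormSq_nonneg _
    rw [Real.norm_of_nonneg (by positivity)]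
    have := hφB x
    nlinarith
  have i_Tj : ∀ j, Integrable (fun x => ⟪fderiv ℝ v x (e j), fderiv ℝ v x (fderiv ℝ v x (e j))⟫)
      volume := by
    intro j
    have hdom : Integrable (fun x => B₁ * ‖fderiv ℝ v x (e j)‖ ^ 2) volume := (i_a j).const_mul _
    refine hdom.mono' ((cdiv j).inner (cDv.clm_apply (cdiv j))).aestronglyMeasurable
      (Eventually.of_forall fun x => ?_)
    calc ‖⟪fderiv ℝ v x (e j), fderiv ℝ v x (fderiv ℝ v x (e j))⟫‖
        ≤ ‖fderiv ℝ v x (e j)‖ * ‖fderiv ℝ v x (fderiv ℝ v x (e j))‖ := norm_inner_le_norm _ _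
      _ ≤ ‖fderiv ℝ v x (e j)‖ * (B₁ * ‖fderiv ℝ v x (e j)‖) :=
          mul_le_mul_of_nonneg_left ((fderiv ℝ v x).le_of_opNorm_le (hB₁ x) _) (norm_nonneg _)
      _ = B₁ * ‖fderiv ℝ v x (e j)‖ ^ 2 := by ring
  set a : Fin 3 → ℝ := fun j => ∫ x, ‖fderiv ℝ v x (e j)‖ ^ 2 with ha
  set R : Fin 3 → ℝ := fun j => ∑ i, ∫ x, ‖fderiv ℝ (fun y => fderiv ℝ v y (e j)) x (e i)‖ ^ 2
    with hR
  set P : Fin 3 → ℝ := fun j => 2 * ∫ x, φ x * ‖fderiv ℝ v x (e j)‖ ^ 2 with hP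
  have ha0 : ∀ j, 0 ≤ a j := fun j => integral_nonneg fun x => sq_nonneg _
  have hR0 : ∀ j, 0 ≤ R j := fun j => Finset.sum_nonneg fun i _ => integral_nonneg fun x => sq_nonneg _
  -- `Σⱼ aⱼ = ∫ |∇v|²_F`, `Σⱼ Rⱼ = ∫ ‖Δv‖²`, `Σⱼ Pⱼ = ∫ 2 φ |∇v|²_F`
  have hsum_a : ∑ j, a j = ∫ x, FluidPDE.frobeniusNormSq (fderiv ℝ v x) := by
    rw [ha, ← integral_finsetSum _ fun j _ => i_a j]
    refine integral_congr_ae (Eventually.of_forall fun x => ?_)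
    simp only
    rw [FluidPDE.frobeniusNormSq_eq_sum e]
  have hHess : ∑ j, R j = ∫ x, ‖(Δ v) x‖ ^ 2 :=
    sum_sum_integral_sq_norm_fderiv_fderiv_eq_integral_sq_norm_laplacian hv3' hv1 hv2 hv3
  have hsum_P : ∑ j, P j = ∫ x, 2 * φ x * FluidPDE.frobeniusNormSq (fderiv ℝ v x) := by
    rw [hP]
    simp only
    rw [← Finset.mul_sum, ← integral_finsetSum _ fun j _ => i_φa j, ← integral_const_mul]
    refine integral_congr_ae (Eventually.of_forall fun x => ?_)
    simp only
    rw [FluidPDE.frobeniusNormSq_eq_sum e, Finset.mul_sum, Finset.mul_sum]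
    refine Finset.sum_congr rfl fun j _ => ?_
    ring
  -- Step 1: `∫ Σᵢ ⟪∂ᵢv, ∂ᵢW⟫ = -∫ ⟪Δv, W⟫`
  have hL := integral_sum_inner_fderiv_fderiv_eq_neg_integral_inner_laplacian hv2' hW i1 i2 i3
  -- Step 2: the pressure term vanishes
  have hpress : ∫ x, ⟪(Δ v) x, gradient q x⟫ = 0 := by
    have hswap : (fun x => ⟪(Δ v) x, gradient q x⟫) = fun x => ⟪gradient q x, (Δ v) x⟫ :=
      funext fun x => real_inner_comm _ _
    rw [hswap]
    refine integral_inner_gradient_eq_zero_of_isDivFree_R3 hq hΔ1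
      (isDivFree_laplacian_of_contDiff_three hv3' hdiv) (fun i => ?_) (fun i => ?_) (fun i => ?_)
    · refine integrable_of_norm_le_mul_of_lintegral_sq
        ((continuous_const.inner cΔ).mul (cdiq i)).aestronglyMeasurable c3D2 (cdiq i) l2Δ (l2diq i)
        fun x => ?_
      rw [norm_mul]
      exact mul_le_mul ((hin i _).trans (n_Δ x)) le_rfl (norm_nonneg _) (norm_nonneg _)
    · refine integrable_of_norm_le_mul_of_lintegral_sq
        ((continuous_const.inner (cdΔ i)).mul cq).aestronglyMeasurable c3D3 cq l2dΔ hq0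
        fun x => ?_
      rw [norm_mul]
      exact mul_le_mul ((hin i _).trans (n_dΔ i x)) le_rfl (norm_nonneg _) (norm_nonneg _)
    · refine integrable_of_norm_le_mul_of_lintegral_sq
        ((continuous_const.inner cΔ).mul cq).aestronglyMeasurable c3D2 cq l2Δ hq0
        fun x => ?_
      rw [norm_mul]
      exact mul_le_mul ((hin i _).trans (n_Δ x)) le_rfl (norm_nonneg _) (norm_nonneg _)
  -- Step 3: the pointwise identity `-⟪Δv, W⟫ = -ν‖Δv‖² + ⟪Δv, (v·∇)v⟫ + ⟪Δv, ∇q⟫`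
  have hpt : ∀ x, -⟪(Δ v) x, W x⟫ =
      -ν * ‖(Δ v) x‖ ^ 2 + ⟪(Δ v) x, FluidPDE.convect v v x⟫ + ⟪(Δ v) x, gradient q x⟫ := by
    intro x
    have hWx : W x = ν • (Δ v) x - FluidPDE.convect v v x - gradient q x := by
      have h : W x = ν • (Δ v) x - gradient q x - FluidPDE.convect v v x :=
        eq_sub_iff_add_eq.2 (hmom x)
      rw [h]; abel
    rw [hWx, inner_sub_right, inner_sub_right, inner_smul_right, real_inner_self_eq_norm_sq]
    ring
  -- Step 4: integrate
  have iA : Integrable (fun x => -ν * ‖(Δ v) x‖ ^ 2) volume := iΔΔ.const_mul _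
  have iAB : Integrable (fun x => -ν * ‖(Δ v) x‖ ^ 2 + ⟪(Δ v) x, FluidPDE.convect v v x⟫) volume :=
    iA.add iΔc
  have hint : ∫ x, -⟪(Δ v) x, W x⟫ =
      -ν * (∫ x, ‖(Δ v) x‖ ^ 2) + (∫ x, ⟪(Δ v) x, FluidPDE.convect v v x⟫) +
        ∫ x, ⟪(Δ v) x, gradient q x⟫ := by
    rw [integral_congr_ae (Eventually.of_forall hpt), integral_add iAB iΔg, integral_add iA iΔc,
      integral_const_mul]
  have hneg_int : ∫ x, -⟪(Δ v) x, W x⟫ = - ∫ x, ⟪(Δ v) x, W x⟫ := integral_neg _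
  -- Step 5: the trilinear term, bounded by the middle principal strain (Miller's Lemma 5.1)
  have htri : ∫ x, ⟪(Δ v) x, FluidPDE.convect v v x⟫ ≤ ∑ j, P j := by
    rw [integral_inner_laplacian_convect_eq_neg_sum hv3' hdiv hB hB₁ hv1 hv2,
      ← integral_finsetSum _ fun j _ => i_Tj j, ← integral_neg, hsum_P]
    have hdet0 := integral_det_fderiv_eq_zero hv hB hB₁ hv1
    have hup : ∫ x, 2 * φ x * FluidPDE.frobeniusNormSq (fderiv ℝ v x) =
        ∫ x, (2 * φ x * FluidPDE.frobeniusNormSq (fderiv ℝ v x) +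
          LinearMap.det (fderiv ℝ v x : EuclideanSpace ℝ (Fin 3) →ₗ[ℝ] EuclideanSpace ℝ (Fin 3))) := by
      rw [integral_add i_φF idet, hdet0, add_zero]
    rw [hup]
    refine integral_mono (integrable_finsetSum _ fun j _ => i_Tj j).neg (i_φF.add idet) fun x => ?_
    simp only
    have h := neg_sum_inner_apply_apply_le_midStrain (fderiv ℝ v x) (hdiv x)
    simpa only [hφdef, mul_assoc] using h
  -- Step 6: the weighted bound on `Σⱼ Pⱼ`
  set C : ℝ := θ * (2 * (1 - θ)) ^ ((1 - θ) / θ) * (K : ℝ) ^ (2 * (1 - θ) / θ) with hC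
  have hC0 : 0 ≤ C := by
    have : 0 ≤ 1 - θ := by linarith
    positivity
  have hstep : ∀ j, P j ≤ ν / 2 * R j + C * ν ^ (1 - 1 / θ) * (2 * Nφ) ^ (1 / θ) * a j := by
    intro j
    have hkj := integral_weight_mul_sq_norm_fderiv_apply_le hv3' hv1 hv2 hφc hφ0 hφB hr hφr j
    rw [← hθ, show 3 / (2 * r) = 1 - θ by rw [hθ]; ring] at hkj
    have hPj : P j ≤ 2 * Nφ * a j ^ θ * ((K : ℝ) ^ 2 * R j) ^ (1 - θ) := by
      have := mul_le_mul_of_nonneg_left hkj (zero_le_two (α := ℝ))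
      simpa only [hP, hNφdef, ha, hR, hK, mul_assoc] using this
    have habs := miller_absorb_component hθ0 hθ1 hν (by positivity : (0 : ℝ) ≤ 2 * Nφ) K.coe_nonneg
      (ha0 j) (hR0 j) hPj
    rw [miller_const_identity hθ0 (by positivity : (0 : ℝ) ≤ 2 * Nφ) K.coe_nonneg] at habs
    rw [hC]
    exact habs
  have h2N : (2 * Nφ) ^ (1 / θ) ≤ (2 : ℝ) ^ (1 / θ) * Nm ^ (1 / θ) := by
    rw [Real.mul_rpow zero_le_two hNφ0]
    exact mul_le_mul_of_nonneg_left (Real.rpow_le_rpow hNφ0 hNφNm (by positivity)) (by positivity)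
  have hkey : ∑ j, P j ≤ ν / 2 * ∑ j, R j +
      C * ν ^ (1 - 1 / θ) * ((2 : ℝ) ^ (1 / θ) * Nm ^ (1 / θ)) * ∑ j, a j := by
    calc ∑ j, P j ≤ ∑ j, (ν / 2 * R j + C * ν ^ (1 - 1 / θ) * (2 * Nφ) ^ (1 / θ) * a j) :=
          Finset.sum_le_sum fun j _ => hstep j
      _ = ν / 2 * ∑ j, R j + C * ν ^ (1 - 1 / θ) * (2 * Nφ) ^ (1 / θ) * ∑ j, a j := by
          rw [Finset.sum_add_distrib, ← Finset.mul_sum, ← Finset.mul_sum]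
      _ ≤ ν / 2 * ∑ j, R j + C * ν ^ (1 - 1 / θ) * ((2 : ℝ) ^ (1 / θ) * Nm ^ (1 / θ)) * ∑ j, a j := by
          have hsa : 0 ≤ ∑ j, a j := Finset.sum_nonneg fun j _ => ha0 j
          have hνp : 0 ≤ ν ^ (1 - 1 / θ) := Real.rpow_nonneg hν.le _
          exact add_le_add le_rfl (mul_le_mul_of_nonneg_right
            (mul_le_mul_of_nonneg_left h2N (mul_nonneg hC0 hνp)) hsa)
  -- Step 7: conclude
  rw [hHess, hsum_a] at hkey
  rw [hL, ← hneg_int, hint, hpress, add_zero]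
  have hL2 : 0 ≤ ∫ x, ‖(Δ v) x‖ ^ 2 := integral_nonneg fun x => sq_nonneg _
  have hfin : C * ν ^ (1 - 1 / θ) * ((2 : ℝ) ^ (1 / θ) * Nm ^ (1 / θ)) *
      ∫ x, FluidPDE.frobeniusNormSq (fderiv ℝ v x) =
      C * (2 : ℝ) ^ (1 / θ) * ν ^ (1 - 1 / θ) * Nm ^ (1 / θ) *
        ∫ x, FluidPDE.frobeniusNormSq (fderiv ℝ v x) := by ring
  rw [hfin] at hkey
  nlinarith [htri, hkey, hL2, hν]

end Slice

/-! ### Grönwall on a slab in Tao's `L²`-Sobolev class -/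

section Slab

/-- **Miller's enstrophy inequality on a slab** (Miller 2019, Thm. 1.1 = Thm. 5.2:
`‖u(T)‖²_{Ḣ¹} ≤ ‖u⁰‖²_{Ḣ¹} exp (C_q ∫₀ᵀ ‖λ₂⁺‖^p_{L^q})`, `2/p + 3/q = 2`, `3/2 < q < ∞`; priority
Neustupa–Penel 2001). Let `(u, p)` be a classical solution of the unforced Navier–Stokes system
with viscosity `ν > 0` on the closed slab `[0, T] × ℝ³` in Tao's `L²`-Sobolev class (`u`, `∂ₜu`,
`p` with all `L²` Sobolev norms bounded on `[0, T]`), `3/2 < r < ∞`, `θ = 1 - 3/(2r)`, and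
`0 < s ≤ T`. Let `m ≥ 0` be, at every `t ∈ (0, s)` and every `x`, a majorant of the middle
principal strain `λ₂(∇u(t,x))` in the two-frame Courant–Fischer form, with
`A = ∫₀ˢ (∫ m(t,x)^r dx)^{2/(2r-3)} dt < ∞` (lower integrals; `(∫ m^r)^{2/(2r-3)} = ‖m‖^p_{L^r}`,
`p = 2r/(2r-3)`). Then `∫ |∇u(s)|²_F ≤ exp (2 (C(θ) 2^{1/θ} + 1) ν^{1-1/θ} A) ∫ |∇u(0)|²_F`,
`C(θ) = θ (2(1-θ))^{(1-θ)/θ} K^{2(1-θ)/θ}`.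
Proof: the balance `IsSmoothSpaceTimeOn.enstrophy_balance`, the slice bound
`integral_sum_inner_fderiv_le_of_momentum_of_midStrain` at every `t ∈ (0, s)` with
`∫ m(t)^r < ∞` (at the other times the Grönwall density is `+∞`, and the production vanishes
when the enstrophy does), and Grönwall's lemma `lintegral_gronwall_le` in `ℝ≥0∞` (no
measurability of `m` is needed). [cite: Miller2019, Thm 1.1 (proof of Thm 5.2)]
[cite: NeustupaPenel2001, Thm 2] -/
theorem miller_enstrophy_le_mul_exp {ν T : ℝ} (hν : 0 < ν) (hT : 0 < T)
    {u : ℝ → EuclideanSpace ℝ (Fin 3) → EuclideanSpace ℝ (Fin 3)}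
    {p : ℝ → EuclideanSpace ℝ (Fin 3) → ℝ} (hsol : FluidPDE.IsClassicalNSSolutionOn (Icc 0 T) ν 0 u p)
    (hu : HasBoundedSobolevNormsOn (Icc 0 T) u)
    (hut : HasBoundedSobolevNormsOn (Icc 0 T) (FluidPDE.timeDerivWithin (Icc 0 T) u))
    (hp : ∀ n : ℕ, ∃ C : ℝ≥0, ∀ t ∈ Icc 0 T, ∫⁻ x, ‖iteratedFDeriv ℝ n (p t) x‖ₑ ^ 2 ≤ C)
    {r : ℝ} (hr : 3 / 2 < r) {θ : ℝ} (hθ : θ = 1 - 3 / (2 * r))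
    {m : ℝ → EuclideanSpace ℝ (Fin 3) → ℝ} (hm0 : ∀ t x, 0 ≤ m t x)
    {s : ℝ} (hs : s ∈ Ioc 0 T)
    (hmaj : ∀ t ∈ Ioo 0 s, ∀ x, ∃ y z : EuclideanSpace ℝ (Fin 3), ‖y‖ = 1 ∧ ‖z‖ = 1 ∧
      ⟪y, z⟫ = 0 ∧ ∀ α β : ℝ,
        ⟪fderiv ℝ (u t) x (α • y + β • z), α • y + β • z⟫ ≤ m t x * (α ^ 2 + β ^ 2))
    (hA : ∫⁻ t in Ioo 0 s, (∫⁻ x, ENNReal.ofReal (m t x) ^ r) ^ (2 / (2 * r - 3)) ≠ ⊤) :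
    ∫⁻ x, ENNReal.ofReal (FluidPDE.frobeniusNormSq (fderiv ℝ (u s) x)) ≤
      ENNReal.ofReal (Real.exp (2 * (θ * (2 * (1 - θ)) ^ ((1 - θ) / θ) *
          (SNormLESNormFDerivOfEqConst (EuclideanSpace ℝ (Fin 3))
            (volume : Measure (EuclideanSpace ℝ (Fin 3))) 2 : ℝ) ^ (2 * (1 - θ) / θ) *
            (2 : ℝ) ^ (1 / θ) + 1) *
          ν ^ (1 - 1 / θ) *
          (∫⁻ t in Ioo 0 s, (∫⁻ x, ENNReal.ofReal (m t x) ^ r) ^ (2 / (2 * r - 3))).toReal)) *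
        ∫⁻ x, ENNReal.ofReal (FluidPDE.frobeniusNormSq (fderiv ℝ (u 0) x)) := by
  set e := EuclideanSpace.basisFun (Fin 3) ℝ with he
  set K : ℝ≥0 := SNormLESNormFDerivOfEqConst (EuclideanSpace ℝ (Fin 3))
    (volume : Measure (EuclideanSpace ℝ (Fin 3))) 2 with hK
  set C : ℝ := θ * (2 * (1 - θ)) ^ ((1 - θ) / θ) * (K : ℝ) ^ (2 * (1 - θ) / θ) *
    (2 : ℝ) ^ (1 / θ) with hC
  have hU : UniqueDiffOn ℝ (Icc 0 T) := uniqueDiffOn_Icc hT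
  set W : ℝ → EuclideanSpace ℝ (Fin 3) → EuclideanSpace ℝ (Fin 3) :=
    FluidPDE.timeDerivWithin (Icc 0 T) u with hW
  have hWsm : FluidPDE.IsSmoothSpaceTimeOn (Icc 0 T) W := hsol.smooth_velocity.timeDerivWithin hU
  -- the exponents
  have hρ0 : 0 < r := by linarith
  have hθ0 : 0 < θ := by
    rw [hθ, sub_pos, div_lt_one (by positivity)]; linarith
  have hθ1 : θ < 1 := by
    rw [hθ]; linarith [div_pos (zero_lt_three' ℝ) (by positivity : (0 : ℝ) < 2 * r)]
  have hC0 : 0 ≤ C := by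
    have : 0 ≤ 1 - θ := by linarith
    positivity
  have he0 : 0 < 2 / (2 * r - 3) := div_pos two_pos (by linarith)
  have hexp : 1 / r * (1 / θ) = 2 / (2 * r - 3) := by
    have h23 : (2 * r - 3) ≠ 0 := by
      have : 0 < 2 * r - 3 := by linarith
      exact this.ne'
    have hθ' : θ = (2 * r - 3) / (2 * r) := by rw [hθ]; field_simp
    rw [hθ']
    field_simp
  -- pointwise bounds on `u` and `Du` over the slab (Sobolev)
  obtain ⟨B₀, hB₀⟩ := linfty_bound_of_hasBoundedSobolevNormsOn_holds
    (fun t ht => (hsol.contDiff_velocity ht).of_le (by norm_cast)) hu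
  obtain ⟨B₁, -, hB₁⟩ := exists_forall_norm_fderiv_le_of_hasBoundedSobolevNormsOn
    (fun t ht => (hsol.contDiff_velocity ht).of_le (by norm_cast)) hu
  obtain ⟨C₁, hC₁⟩ := hu 1
  obtain ⟨D₂, hD₂⟩ := hu 2
  obtain ⟨D₃, hD₃⟩ := hu 3
  obtain ⟨E₀, hE₀⟩ := hut 0
  obtain ⟨E₁, hE₁⟩ := hut 1
  obtain ⟨P₀, hP₀⟩ := hp 0
  obtain ⟨P₁, hP₁⟩ := hp 1
  have hzero : ∀ {f : EuclideanSpace ℝ (Fin 3) → EuclideanSpace ℝ (Fin 3)} {C' : ℝ≥0},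
      (∫⁻ x, ‖iteratedFDeriv ℝ 0 f x‖ₑ ^ 2 ≤ C') → ∫⁻ x, ‖f x‖ₑ ^ 2 < ⊤ := by
    intro f C' h
    refine lt_of_le_of_lt ((le_of_eq (lintegral_congr fun x => ?_)).trans h) ENNReal.coe_lt_top
    rw [← ofReal_norm, ← ofReal_norm, norm_iteratedFDeriv_zero]
  have hzero' : ∀ {f : EuclideanSpace ℝ (Fin 3) → ℝ} {C' : ℝ≥0},
      (∫⁻ x, ‖iteratedFDeriv ℝ 0 f x‖ₑ ^ 2 ≤ C') → ∫⁻ x, ‖f x‖ₑ ^ 2 < ⊤ := by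
    intro f C' h
    refine lt_of_le_of_lt ((le_of_eq (lintegral_congr fun x => ?_)).trans h) ENNReal.coe_lt_top
    rw [← ofReal_norm, ← ofReal_norm, norm_iteratedFDeriv_zero]
  -- the enstrophy balance
  obtain ⟨hΦint, hGcont, hGb⟩ := hsol.smooth_velocity.enstrophy_balance hT hC₁ hE₁
  set Φ : ℝ → ℝ := fun t => ∫ x, 2 * ∑ i, ⟪fderiv ℝ (u t) x (e i), fderiv ℝ (W t) x (e i)⟫ with hΦ
  set G : ℝ → ℝ := fun t => ∫ x, FluidPDE.frobeniusNormSq (fderiv ℝ (u t) x) with hG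
  have hG0 : ∀ t, 0 ≤ G t := fun t => integral_nonneg fun x => FluidPDE.frobeniusNormSq_nonneg _
  have hfrob_le : ∀ t ∈ Icc 0 T,
      ∫⁻ x, ENNReal.ofReal (FluidPDE.frobeniusNormSq (fderiv ℝ (u t) x)) ≤ 3 * C₁ := by
    intro t ht
    calc ∫⁻ x, ENNReal.ofReal (FluidPDE.frobeniusNormSq (fderiv ℝ (u t) x))
        ≤ ∫⁻ x, 3 * ‖iteratedFDeriv ℝ 1 (u t) x‖ₑ ^ 2 := lintegral_mono fun x => by
          rw [← ofReal_norm, norm_iteratedFDeriv_one, ofReal_norm]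
          exact ofReal_frobeniusNormSq_le_three_mul_enorm_sq _
      _ = 3 * ∫⁻ x, ‖iteratedFDeriv ℝ 1 (u t) x‖ₑ ^ 2 := lintegral_const_mul' _ _ (by norm_num)
      _ ≤ 3 * C₁ := by gcongr; exact hC₁ t ht
  have hfrob_lt : ∀ t ∈ Icc 0 T,
      ∫⁻ x, ENNReal.ofReal (FluidPDE.frobeniusNormSq (fderiv ℝ (u t) x)) < ⊤ := fun t ht =>
    lt_of_le_of_lt (hfrob_le t ht) (ENNReal.mul_lt_top (by norm_num) ENNReal.coe_lt_top)
  have ifrob : ∀ t ∈ Icc 0 T, Integrable (fun x => FluidPDE.frobeniusNormSq (fderiv ℝ (u t) x)) volume :=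
    fun t ht => integrable_of_continuous_of_nonneg
      (FluidPDE.continuous_frobeniusNormSq_fderiv (hsol.contDiff_velocity ht) (by simp))
      (fun x => FluidPDE.frobeniusNormSq_nonneg _) (hfrob_lt t ht)
  have hGeq : ∀ t ∈ Icc 0 T, ENNReal.ofReal (G t) =
      ∫⁻ x, ENNReal.ofReal (FluidPDE.frobeniusNormSq (fderiv ℝ (u t) x)) := fun t ht =>
    ofReal_integral_eq_lintegral_ofReal (ifrob t ht)
      (Eventually.of_forall fun x => FluidPDE.frobeniusNormSq_nonneg _)
  -- the weight `A t = ∫ m(t)^r` and `Nq t = ‖m(t)‖_{L^r}^{1/θ}`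
  set A : ℝ → ℝ≥0∞ := fun t => ∫⁻ x, ENNReal.ofReal (m t x) ^ r with hAdef
  set Nq : ℝ → ℝ := fun t => ((A t) ^ (1 / r)).toReal ^ (1 / θ) with hNq
  have hNq0 : ∀ t, 0 ≤ Nq t := fun t => Real.rpow_nonneg ENNReal.toReal_nonneg _
  have hNqA : ∀ t, A t ≠ ⊤ → ENNReal.ofReal (Nq t) = (A t) ^ (2 / (2 * r - 3)) := by
    intro t ht
    have h1 : Nq t = ((A t) ^ (2 / (2 * r - 3))).toReal := by
      rw [hNq]
      simp only
      rw [ENNReal.toReal_rpow, ← ENNReal.rpow_mul, hexp]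
    rw [h1, ENNReal.ofReal_toReal]
    exact ENNReal.rpow_ne_top_of_nonneg he0.le ht
  set κ : ℝ := 2 * (C + 1) * ν ^ (1 - 1 / θ) with hκ
  have hνp : 0 < ν ^ (1 - 1 / θ) := Real.rpow_pos_of_pos hν _
  have hκ0 : 0 < κ := by positivity
  -- the production bound at interior times with `∫ m(t)^r < ∞`: `Φ t ≤ κ Nq t G t`
  have hslice : ∀ t ∈ Ioo 0 s, A t ≠ ⊤ → Φ t ≤ κ * Nq t * G t := by
    intro t ht hAt
    have htI : t ∈ Icc 0 T := ⟨ht.1.le, ht.2.le.trans hs.2⟩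
    have hmom : ∀ x, W t x + FluidPDE.convect (u t) (u t) x = ν • (Δ (u t)) x - gradient (p t) x := by
      intro x
      have h := hsol.momentum t htI x
      simpa [hW] using h
    have hsl := integral_sum_inner_fderiv_le_of_momentum_of_midStrain hν
      (hsol.contDiff_velocity htI)
      ((hWsm.contDiff_slice htI).of_le (by norm_cast))
      ((hsol.contDiff_pressure htI).of_le (by norm_cast)) hmom (hsol.divFree t htI)
      (fun x => hB₀ t htI x) (fun x => hB₁ t htI x) hr hθ (hm0 t) (hmaj t ht) hAt.lt_top
      ((hC₁ t htI).trans_lt ENNReal.coe_lt_top) ((hD₂ t htI).trans_lt ENNReal.coe_lt_top)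
      ((hD₃ t htI).trans_lt ENNReal.coe_lt_top)
      (hzero (hE₀ t htI)) ((hE₁ t htI).trans_lt ENNReal.coe_lt_top)
      (hzero' (hP₀ t htI)) ((hP₁ t htI).trans_lt ENNReal.coe_lt_top)
    have h2 : Φ t = 2 * ∫ x, ∑ i, ⟪fderiv ℝ (u t) x (e i), fderiv ℝ (W t) x (e i)⟫ := by
      rw [hΦ]
      exact integral_const_mul _ _
    rw [h2]
    have := mul_le_mul_of_nonneg_left hsl (zero_le_two (α := ℝ))
    refine this.trans ?_
    have hNG : 0 ≤ Nq t * G t := mul_nonneg (hNq0 t) (hG0 t)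
    have hid : 2 * ((θ * (2 * (1 - θ)) ^ ((1 - θ) / θ) * (K : ℝ) ^ (2 * (1 - θ) / θ) *
        (2 : ℝ) ^ (1 / θ)) * ν ^ (1 - 1 / θ) *
        ((∫⁻ x, ENNReal.ofReal (m t x) ^ r) ^ (1 / r)).toReal ^ (1 / θ) *
        ∫ x, FluidPDE.frobeniusNormSq (fderiv ℝ (u t) x)) =
        2 * C * ν ^ (1 - 1 / θ) * (Nq t * G t) := by
      simp only [hC, hNq, hG, hAdef]
      ring
    rw [hid]
    have hmono : 2 * C * ν ^ (1 - 1 / θ) * (Nq t * G t) ≤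
        2 * (C + 1) * ν ^ (1 - 1 / θ) * (Nq t * G t) := by
      have : 0 ≤ ν ^ (1 - 1 / θ) * (Nq t * G t) := mul_nonneg hνp.le hNG
      nlinarith
    calc 2 * C * ν ^ (1 - 1 / θ) * (Nq t * G t)
        ≤ 2 * (C + 1) * ν ^ (1 - 1 / θ) * (Nq t * G t) := hmono
      _ = κ * Nq t * G t := by rw [hκ]; ring
  -- at a time of zero enstrophy the production vanishes
  have hbad : ∀ τ ∈ Icc 0 T, G τ = 0 → Φ τ = 0 := by
    intro τ hτ hGz
    have hcu : Continuous fun x => FluidPDE.frobeniusNormSq (fderiv ℝ (u τ) x) :=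
      FluidPDE.continuous_frobeniusNormSq_fderiv (hsol.contDiff_velocity hτ) (by simp)
    have hae := (integral_eq_zero_iff_of_nonneg (fun x => FluidPDE.frobeniusNormSq_nonneg _)
      (ifrob τ hτ)).1 hGz
    have h0 : (fun x => FluidPDE.frobeniusNormSq (fderiv ℝ (u τ) x)) = 0 :=
      (Continuous.ae_eq_iff_eq volume hcu continuous_zero).1 hae
    have hD0 : ∀ x, fderiv ℝ (u τ) x = 0 := fun x =>
      (frobeniusNormSq_eq_zero_iff _).1 (by simpa using congrFun h0 x)
    rw [hΦ]
    simp [hD0]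
  -- Grönwall in `ℝ≥0∞`
  set φE : ℝ → ℝ≥0∞ := fun t => ENNReal.ofReal (G t) with hφE
  set aE : ℝ → ℝ≥0∞ := fun t => ENNReal.ofReal κ * (A t) ^ (2 / (2 * r - 3)) with haE
  have hM : ∀ t ∈ Icc 0 s, φE t ≤ 3 * C₁ := fun t ht => by
    rw [hφE]; simp only; rw [hGeq t ⟨ht.1, ht.2.trans hs.2⟩]
    exact hfrob_le t ⟨ht.1, ht.2.trans hs.2⟩
  have haS : ∫⁻ t in Ioo 0 s, aE t ≠ ⊤ := by
    rw [haE]; simp only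
    rw [lintegral_const_mul' _ _ ENNReal.ofReal_ne_top]
    exact ENNReal.mul_ne_top ENNReal.ofReal_ne_top hA
  -- the pointwise comparison `ofReal (Φ τ) ≤ aE τ * φE τ` at every `τ ∈ (0, s)`
  have hcmp : ∀ τ ∈ Ioo 0 s, ENNReal.ofReal (Φ τ) ≤ aE τ * φE τ := by
    intro τ hτs
    have hτT : τ ∈ Icc 0 T := ⟨hτs.1.le, hτs.2.le.trans hs.2⟩
    by_cases hAt : A τ = ⊤
    · by_cases hGz : G τ = 0
      · rw [hbad τ hτT hGz, ENNReal.ofReal_zero]; exact bot_le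
      · have hGpos : 0 < G τ := lt_of_le_of_ne (hG0 τ) (Ne.symm hGz)
        have hκE : ENNReal.ofReal κ ≠ 0 := by
          rw [Ne, ENNReal.ofReal_eq_zero, not_le]; exact hκ0
        have h1 : aE τ = ⊤ := by
          rw [haE]; simp only; rw [hAt, ENNReal.top_rpow_of_pos he0, ENNReal.mul_top hκE]
        have h2 : φE τ ≠ 0 := by
          rw [hφE]; simp only; rw [Ne, ENNReal.ofReal_eq_zero, not_le]; exact hGpos
        rw [h1, ENNReal.top_mul h2]; exact le_top
    · calc ENNReal.ofReal (Φ τ) ≤ ENNReal.ofReal (κ * Nq τ * G τ) :=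
            ENNReal.ofReal_le_ofReal (hslice τ hτs hAt)
        _ = aE τ * φE τ := by
            rw [haE, hφE]; simp only
            rw [ENNReal.ofReal_mul (mul_nonneg hκ0.le (hNq0 τ)), ENNReal.ofReal_mul hκ0.le,
              hNqA τ hAt]
  have hineq : ∀ t ∈ Icc 0 s, φE t ≤ φE 0 + ∫⁻ τ in Ioo 0 t, aE τ * φE τ := by
    intro t ht
    rcases eq_or_lt_of_le ht.1 with h0 | ht0
    · rw [← h0]; simp
    have htT : t ∈ Ioc 0 T := ⟨ht0, ht.2.trans hs.2⟩
    -- `ofReal (∫ Φ) ≤ ∫⁻ ofReal Φ ≤ ∫⁻ a φ`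
    have hΦt : IntegrableOn Φ (Ioo 0 t) volume := hΦint.mono_set (Ioo_subset_Ioo le_rfl htT.2)
    have h1 : ENNReal.ofReal (∫ τ in Ioo 0 t, Φ τ) ≤ ∫⁻ τ in Ioo 0 t, ENNReal.ofReal (Φ τ) := by
      calc ENNReal.ofReal (∫ τ in Ioo 0 t, Φ τ) ≤ ENNReal.ofReal (∫ τ in Ioo 0 t, max (Φ τ) 0) :=
            ENNReal.ofReal_le_ofReal (integral_mono hΦt hΦt.pos_part fun τ => le_max_left _ _)
        _ = ∫⁻ τ in Ioo 0 t, ENNReal.ofReal (max (Φ τ) 0) :=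
            ofReal_integral_eq_lintegral_ofReal hΦt.pos_part (Eventually.of_forall fun τ => le_max_right _ _)
        _ = ∫⁻ τ in Ioo 0 t, ENNReal.ofReal (Φ τ) := lintegral_congr fun τ => by
            rcases le_total (Φ τ) 0 with h | h
            · rw [max_eq_right h, ENNReal.ofReal_zero, ENNReal.ofReal_of_nonpos h]
            · rw [max_eq_left h]
    have h2 : ∫⁻ τ in Ioo 0 t, ENNReal.ofReal (Φ τ) ≤ ∫⁻ τ in Ioo 0 t, aE τ * φE τ := by
      refine lintegral_mono_ae ((ae_restrict_iff' measurableSet_Ioo).2 (Eventually.of_forall ?_))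
      intro τ hτt
      exact hcmp τ ⟨hτt.1, hτt.2.trans_le ht.2⟩
    calc φE t = ENNReal.ofReal (G 0 + ∫ τ in (0 : ℝ)..t, Φ τ) := by
          rw [hφE]; simp only; congr 1; exact hGb t htT
      _ ≤ ENNReal.ofReal (G 0) + ENNReal.ofReal (∫ τ in (0 : ℝ)..t, Φ τ) := ENNReal.ofReal_add_le
      _ = φE 0 + ENNReal.ofReal (∫ τ in Ioo 0 t, Φ τ) := by
          rw [intervalIntegral.integral_of_le ht.1, integral_Ioc_eq_integral_Ioo]
      _ ≤ φE 0 + ∫⁻ τ in Ioo 0 t, aE τ * φE τ := by gcongr; exact h1.trans h2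
  have hgron := lintegral_gronwall_le (S := s) ENNReal.ofReal_ne_top
    (ENNReal.mul_ne_top (by norm_num) ENNReal.coe_ne_top) hM haS hineq s ⟨hs.1.le, le_rfl⟩
  -- unpack
  have hint_a : (∫⁻ τ in Ioo 0 s, aE τ).toReal =
      κ * (∫⁻ t in Ioo 0 s, (A t) ^ (2 / (2 * r - 3))).toReal := by
    rw [haE]; simp only
    rw [lintegral_const_mul' _ _ ENNReal.ofReal_ne_top, ENNReal.toReal_mul, ENNReal.toReal_ofReal hκ0.le]
  rw [hint_a] at hgron
  rw [← hGeq s ⟨hs.1.le, hs.2⟩, ← hGeq 0 ⟨le_rfl, hT.le⟩, mul_comm]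
  convert hgron using 3

/-- **Miller's enstrophy inequality, packaged**: for every `3/2 < r < ∞` there is a constant
`C ≥ 0` (depending only on `r`) such that for every classical solution of the unforced
Navier–Stokes system on a closed slab `[0, T] × ℝ³` in Tao's `L²`-Sobolev class, every
`0 < s ≤ T`, and every nonnegative two-frame majorant `m` of the middle principal strain on
`(0, s) × ℝ³` with `A = ∫₀ˢ (∫ m(t)^r)^{2/(2r-3)} dt < ∞`,
`∫ |∇u(s)|²_F ≤ exp (C ν^{1-p} A) ∫ |∇u(0)|²_F`, `p = 1/(1 - 3/(2r))` (Miller 2019, Thm. 1.1;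
Neustupa–Penel 2001). [cite: Miller2019, Thm 1.1 (proof of Thm 5.2)] -/
theorem miller_enstrophy_bound {r : ℝ} (hr : 3 / 2 < r) :
    ∃ C : ℝ, 0 ≤ C ∧ ∀ {ν T : ℝ} (_ : 0 < ν) (_ : 0 < T)
      {u : ℝ → EuclideanSpace ℝ (Fin 3) → EuclideanSpace ℝ (Fin 3)}
      {p : ℝ → EuclideanSpace ℝ (Fin 3) → ℝ} (_ : FluidPDE.IsClassicalNSSolutionOn (Icc 0 T) ν 0 u p)
      (_ : HasBoundedSobolevNormsOn (Icc 0 T) u)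
      (_ : HasBoundedSobolevNormsOn (Icc 0 T) (FluidPDE.timeDerivWithin (Icc 0 T) u))
      (_ : ∀ n : ℕ, ∃ C' : ℝ≥0, ∀ t ∈ Icc 0 T, ∫⁻ x, ‖iteratedFDeriv ℝ n (p t) x‖ₑ ^ 2 ≤ C')
      {m : ℝ → EuclideanSpace ℝ (Fin 3) → ℝ} (_ : ∀ t x, 0 ≤ m t x)
      {s : ℝ} (_ : s ∈ Ioc 0 T)
      (_ : ∀ t ∈ Ioo 0 s, ∀ x, ∃ y z : EuclideanSpace ℝ (Fin 3), ‖y‖ = 1 ∧ ‖z‖ = 1 ∧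
        ⟪y, z⟫ = 0 ∧ ∀ α β : ℝ,
          ⟪fderiv ℝ (u t) x (α • y + β • z), α • y + β • z⟫ ≤ m t x * (α ^ 2 + β ^ 2))
      (_ : ∫⁻ t in Ioo 0 s, (∫⁻ x, ENNReal.ofReal (m t x) ^ r) ^ (2 / (2 * r - 3)) ≠ ⊤),
      ∫⁻ x, ENNReal.ofReal (FluidPDE.frobeniusNormSq (fderiv ℝ (u s) x)) ≤
        ENNReal.ofReal (Real.exp (C * ν ^ (1 - 1 / (1 - 3 / (2 * r))) *
            (∫⁻ t in Ioo 0 s, (∫⁻ x, ENNReal.ofReal (m t x) ^ r) ^ (2 / (2 * r - 3))).toReal)) *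
          ∫⁻ x, ENNReal.ofReal (FluidPDE.frobeniusNormSq (fderiv ℝ (u 0) x)) := by
  set θ : ℝ := 1 - 3 / (2 * r) with hθ
  set K : ℝ≥0 := SNormLESNormFDerivOfEqConst (EuclideanSpace ℝ (Fin 3))
    (volume : Measure (EuclideanSpace ℝ (Fin 3))) 2 with hK
  have hρ0 : 0 < r := by linarith
  have hθ0 : 0 < θ := by
    rw [hθ, sub_pos, div_lt_one (by positivity)]; linarith
  have hθ1 : 0 ≤ 1 - θ := by
    rw [hθ]; linarith [div_pos (zero_lt_three' ℝ) (by positivity : (0 : ℝ) < 2 * r)]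
  refine ⟨2 * (θ * (2 * (1 - θ)) ^ ((1 - θ) / θ) * (K : ℝ) ^ (2 * (1 - θ) / θ) *
    (2 : ℝ) ^ (1 / θ) + 1), by positivity, ?_⟩
  intro ν T hν hT u p hsol hu hut hp m hm0 s hs hmaj hA
  exact miller_enstrophy_le_mul_exp hν hT hsol hu hut hp hr hθ hm0 hs hmaj hA

end Slab

end Literature.Analysis.FluidPDE

end
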